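/-
Copyright (c) 2026 the pub-hodgecm-mathlib formalisation cell (harness21).  Prover seat hodgecm-mathlib-K2E1-p12 (g5), Track B ∕ K2-LIT, h413 = `stmt-HodgeConjecture-24833`,
R90-TF section S8 «ContSpec-n½», sub-socket (R), letter ℓ-ROAD (S8 dealer R90-CS-plan (g3), S8-R160 2026-09-05T00:19:42Z): the road letter `hROAD` of ★ p863422 OF LETTERS — the
Maass–Selberg bound from the TUBE-FREE ★ chain (★ p863423 ∘ ★ p862892 ∘ ★ p862829), the domain bookkeeping in-file, leaving the bare continuation and the continued scalars visible.
-/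
import Summits.HodgeConjecture.HodgeConjecture.Theorems.R90S8ResGMidBlockCTRoadOfLettersU3     -- ★ p863518 (this seat): `ctPackage_of_scalarRoad` (+ ★ p863422 `opRoadPackage_of_letters`, ★ p863331 spine, ★ p862884, ★ p863227, ★ p863180)
import Summits.HodgeConjecture.HodgeConjecture.Theorems.K2E1ChiResidueNormSqOfTubeCMThree        -- ★ p863403 (K2E1-p16): the composed MS chain (brings ★ p862892 `msRel_of_tube_letters`, ★ p862829 `msBound_middlePole_of_chiRelation`)
import Summits.HodgeConjecture.HodgeConjecture.Theorems.K2E1ChiMaassSelbergTubeFreeCMThree        -- ★ p863423 (K2E1-p16): `maassSelberg_chiPair_cm_three_self_free` (the tube formula WITHOUT `hdec′`)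
import Literature.AlgebraicTopology.FundamentalGroup.FreeGroupPuncturedPlane                     -- ★ `isPathConnected_convex_diff_finite` (a convex open planar domain minus finitely many points is path connected)
import Literature.NumberTheory.Automorphic.IdeleClassIntegration                                  -- ★ `exists_isIdeleClassDomain`
import Literature.NumberTheory.Automorphic.UnitaryGroupTorusIdeleUnfolding                       -- ★ `locallyCompactSpace_secondCountable_t2_idele`
import Literature.NumberTheory.Automorphic.AdeleGaloisDescent                                      -- ★ `AdeleRing.ideleBaseChange_posRealIdele`
import Mathlib.Analysis.Complex.Convex                                                             -- Mathlib `convex_halfSpace_re_gt`, `convex_halfSpace_im_gt`, `convex_halfSpace_im_lt`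
import HarnessLib

/-!
# S8 sub-socket (R), letter ℓ-ROAD OF LETTERS — `R90S8ResGMidBlockMSRoadOfLettersU3`

Track B ∕ R90-TF, crux h413 = `stmt-HodgeConjecture-24833`, route `HCCMUnconditional`; cell `hodgecm-mathlib`, S8 «ContSpec-n½», sub-socket (R) `sock_S8_res_midBlock_le_residual` ((R)′, B ED. 7).
THEOREMS ONLY (no `def`∕`instance`∕`notation`, no named-fact hypothesis, no `sorry`, default heartbeats); lane `--supports … --as helper`; CLOSES NO SOCKET.  ★ p863518 made (R)′ «★ modulo
{L1 `hDISC`, ℓ-ROAD `hROAD`, `hSCAL`}»; here ℓ-ROAD is replaced by its two genuine constituents — the BARE CONTINUATION of the truncated family (`hCONT`: `Fam` holomorphic on the slit plane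
`{1<Re} ∖ (Sp ∪ S)`, `S` finite real, `Fam z =ᵐ Λ^T Ec z` there) and the CONTINUED SCALARS with their pole data at `3∕2` (`hSCAT`: ★ p863403's (L2)(L3) clauses VERBATIM at the mid-block
character, ∀ Haar `μ_K` on `K_max`, Haar `ν_I` on `𝔸_L^×`, idele class domain `𝓕_I`) — both over `hOP`'s frame ENRICHED by `(ν.IsInvInvariant) (ν 𝓕 = 1)` (★ p863403 needs a NORMALISED
Heisenberg package; §2 chooses one: ★ `exists_unipotent_haar_fundamentalDomain_cm_three` rescaled by `(ν 𝓕)⁻¹`): (R)′ = «★ modulo {L1, hCONT, hSCAT, hSCAL}».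
* §0 `msBound_middlePole_of_tube_letters_free` — ★ p863403's chain RE-CUT TUBE-FREE over ★ p863423 `maassSelberg_chiPair_cm_three_self_free` (the decay letter `hdec′` is gone);
* §0b `midBlockChar_posRealIdele` — the mid-block character is trivial on the positive real ideles (`bcη`, `bcψ` trivial on `𝔸_{L⁺}^×`, `ε² = 1`);
* §1 `roadData_of_tubeLetters` — one generator: CONT + SCAT data ⊢ ★ p863422's ROAD package (`D := {1<Re} ∖ (Sp ∪ S)` open, preconnected by ★ `isPathConnected_convex_diff_finite`,
  `σ₀ := 3 + Σ|Re s|`, punctured `3∕2` inside; `hMS` by §0 on the quarter planes `{1<Re, ±Im>0}` with the boxes `(2.3,2.4)×(0,1)`, `(2.1,2.2)×(0,1)` and mirrors; structural data CHOSEN);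
* §2 HEAD `res_midBlock_le_residual_of_letters'''` `(hDISC) (hCONT) (hSCAT) (hSCAL)` — (R)′'s bytes (★ p863331's spine at the normalised package, ★ p863518 §1, ★ p863422 §1).
HONEST LABEL: HC_CM is proved only modulo the 7 printed citations (2 remaining named inputs: hLiu418 = `stmt-HodgeConjecture-24832`, h413 = `stmt-HodgeConjecture-24833`) until
rung 0 closes; REL ≠ ★ ≠ BUILT; this file asserts no named fact, is conditional by construction on hCONT + hSCAT (+ L1, hSCAL), and closes no socket; count-neutral.

## References
* [MoeglinWaldspurger1995] C. Mœglin, J.-L. Waldspurger, *Spectral Decomposition and Eisenstein Series* (1995), I.2.18, IV.1.11, IV.2.3, IV.3.12 (a), V.3.13.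
* [Arthur1980TraceFormulaII] J. Arthur, *A trace formula for reductive groups II*, Compositio Math. 40 (1980), §4.
* [Langlands1976] R. P. Langlands, *On the Functional Equations Satisfied by Eisenstein Series*, LNM 544 (1976), §7.
* [Rogawski1990] J. D. Rogawski, *Automorphic Representations of Unitary Groups in Three Variables* (1990), §12.1 p. 171, §12.2 p. 174, §13.9 p. 229 (ii).
-/

set_option autoImplicit false
set_option linter.dupNamespace false  -- the mandated namespace `…HodgeConjecture.HodgeConjecture.R90.S8` (LEAD #1 L1) repeats the summit's segment

noncomputable section

open MeasureTheory Measure NumberField IsDedekindDomain Set Filter Topology ContRepresentation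
open scoped ENNReal NNReal ComplexConjugate InnerProductSpace Topology
open Literature.MeasureTheory.Group Literature.NumberTheory Literature.NumberTheory.Automorphic Literature.NumberTheory.Automorphic.UnitaryGroup Literature.NumberTheory.GaloisRepresentations AdelicGroupData
open Literature.NumberTheory.Automorphic.Arthur2013.Leaves.TECR Literature.NumberTheory.Rogawski1990
open Literature.AlgebraicTopology.FundamentalGroup (isPathConnected_convex_diff_finite)
open Summit.HodgeConjecture.HodgeConjecture.Cruxes.H413.K2E1BorelEisensteinU Summit.HodgeConjecture.HodgeConjecture.Cruxes.H413.K2E1CharacterEisensteinU2Defs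
open Summit.HodgeConjecture.HodgeConjecture.Cruxes.H413.K2E1CharacterEisensteinU3PairDefs Summit.HodgeConjecture.HodgeConjecture.Cruxes.H413.K2E1ChiSectionSpaceU3PairDefs Summit.HodgeConjecture.HodgeConjecture.Cruxes.H413.K2E1BLBorelSpacesU2Defs
open Summit.HodgeConjecture.HodgeConjecture.Cruxes.H413.K2E1CuspidalSpectrumUnitary (residualSubspace)

namespace Summit.HodgeConjecture.HodgeConjecture.R90.S8

section Free
variable (L : Type) [Field L] [NumberField L] [IsCMField L] [MeasurableSpace (quasiSplit (↥(maximalRealSubfield L)) L (IsCMField.complexConj L) 3).Adelic] [BorelSpace (quasiSplit (↥(maximalRealSubfield L)) L (IsCMField.complexConj L) 3).Adelic]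
  [MeasurableSpace (AdeleRing (𝓞 L) L)ˣ] [BorelSpace (AdeleRing (𝓞 L) L)ˣ]

/-- **★ p863403 `msBound_middlePole_of_tube_letters`, TUBE-FREE** — the same chain (★ p863423 `maassSelberg_chiPair_cm_three_self_free` on the tube with the brackets read as the three
literal scalars → the agreement letters (L2) → ★ p862892 `msRel_of_tube_letters` → ★ p862829 `msBound_middlePole_of_chiRelation`), with the decay letter `hdec′` no longer asked: for the
χ-pair section `φ`, the normalised structural data, (L1) the `L²`-family `F` on the two quarter-plane domains, (L2) the continued scalars, (L3) the pole data,
`∃ C, ‖(z − 3∕2)•F z‖ ≤ C` near `3∕2`. [cite: MoeglinWaldspurger1995, IV.2.3, IV.3.12 (a)] [cite: Arthur1980TraceFormulaII, §4] [cite: Langlands1976, §7] -/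
theorem msBound_middlePole_of_tube_letters_free
    (μ : Measure (quasiSplit (↥(maximalRealSubfield L)) L (IsCMField.complexConj L) 3).automorphicQuotient) [(quasiSplit (↥(maximalRealSubfield L)) L (IsCMField.complexConj L) 3).IsAutomorphicMeasure μ]
    (νG : Measure (quasiSplit (↥(maximalRealSubfield L)) L (IsCMField.complexConj L) 3).Adelic) [νG.IsHaarMeasure] [νG.IsInvInvariant]
    (μK : Measure ((standardMaximalCompactGL 3 L).comap (adelicVal (↥(maximalRealSubfield L)) L (IsCMField.complexConj L) 3 ((StdForm.antidiagonal 3).over L)) : Subgroup (quasiSplit (↥(maximalRealSubfield L)) L (IsCMField.complexConj L) 3).Adelic))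
    [μK.IsHaarMeasure]
    (νI : Measure (AdeleRing (𝓞 L) L)ˣ) [νI.IsHaarMeasure]
    {𝓕I : Set (AdeleRing (𝓞 L) L)ˣ} (h𝓕I : IsIdeleClassDomain L 𝓕I)
    (ν : Measure ↥(adelicUnipotent (↥(maximalRealSubfield L)) L (IsCMField.complexConj L) 3)) [ν.IsHaarMeasure] [ν.IsInvInvariant]
    {𝓕 : Set ↥(adelicUnipotent (↥(maximalRealSubfield L)) L (IsCMField.complexConj L) 3)} (h𝓕N : IsFundamentalDomain ↥(rationalUnipotent (↥(maximalRealSubfield L)) L (IsCMField.complexConj L) 3) 𝓕 ν) (h𝓕1 : ν 𝓕 = 1)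
    (h𝓕c : IsCompact (closure 𝓕))
    {β : (quasiSplit (↥(maximalRealSubfield L)) L (IsCMField.complexConj L) 3).Adelic → ℝ≥0∞} (hβ : IsCoveringWeight ((arithmeticBorel (↥(maximalRealSubfield L)) L (IsCMField.complexConj L) 3).map (quasiSplit (↥(maximalRealSubfield L)) L (IsCMField.complexConj L) 3).arithmeticSubgroup.subtype) β)
    {T : ℝ≥0} (hT : 1 ≤ T)
    {χ₁ : HeckeCharacter L} {χ₂ : ↥(TorusDict.torus (IsCMField.complexConj L)) →ₜ* ℂˣ}
    (hχ₁ : χ₁.IsUnitary) (hρ₁ : ∀ r : ℝ≥0ˣ, χ₁ (posRealIdele L r) = 1) (hχ₂u : ∀ u, ‖((χ₂ u : ℂˣ) : ℂ)‖ = 1) (hχ₂ : TorusDict.IsAutomorphic (IsCMField.complexConj L) χ₂)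
    {φ : (quasiSplit (↥(maximalRealSubfield L)) L (IsCMField.complexConj L) 3).Adelic → ℂ} (hφc : Continuous φ) (hφ : IsChiSectionPair χ₁ χ₂ φ) {Cφ : ℝ} (hφC : ∀ x, ‖φ x‖ ≤ Cφ)
    -- (L1) the domain package and the continued `L²`-family
    {D₁ : Set ℂ} (hD₁ : IsOpen D₁) (hD₁c : IsPreconnected D₁) (hD₁sub : D₁ ⊆ {z : ℂ | 1 < z.re ∧ 0 < z.im})
    {O₁ O₂' : Set ℂ} (hO₁ : IsOpen O₁) (hO₁ne : O₁.Nonempty) (hO₁D : O₁ ⊆ D₁) (hO₂' : IsOpen O₂') (hO₂'ne : O₂'.Nonempty) (hO₂'D : O₂' ⊆ D₁)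
    (hsep : ∀ z ∈ O₁, ∀ z' ∈ O₂', 2 < z'.re ∧ z'.re < z.re)
    {D₂ : Set ℂ} (hD₂ : IsOpen D₂) (hD₂c : IsPreconnected D₂) (hD₂sub : D₂ ⊆ {z : ℂ | 1 < z.re ∧ z.im < 0})
    {Q₁ Q₂' : Set ℂ} (hQ₁ : IsOpen Q₁) (hQ₁ne : Q₁.Nonempty) (hQ₁D : Q₁ ⊆ D₂) (hQ₂' : IsOpen Q₂') (hQ₂'ne : Q₂'.Nonempty) (hQ₂'D : Q₂' ⊆ D₂)
    (hsep₂ : ∀ z ∈ Q₁, ∀ z' ∈ Q₂', 2 < z'.re ∧ z'.re < z.re)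
    (hD₁ev : ∀ᶠ z : ℂ in 𝓝[≠] ((3 / 2 : ℂ)), 0 < z.im → z ∈ D₁) (hD₂ev : ∀ᶠ z : ℂ in 𝓝[≠] ((3 / 2 : ℂ)), z.im < 0 → z ∈ D₂)
    (F : ℂ → Lp ℂ 2 μ) (hFd₁ : DifferentiableOn ℂ F D₁) (hFd₂ : DifferentiableOn ℂ F D₂)
    {V : Set ℂ} (hV : IsOpen V) (hVmem : ∀ᶠ z in 𝓝[≠] ((3 / 2 : ℂ)), z ∈ V) (hFc : ContinuousOn F V)
    (hFtube₁ : (∀ z ∈ D₁, 2 < z.re → ((F z : Lp ℂ 2 μ) : (quasiSplit (↥(maximalRealSubfield L)) L (IsCMField.complexConj L) 3).automorphicQuotient → ℂ) =ᵐ[μ] (quasiSplit (↥(maximalRealSubfield L)) L (IsCMField.complexConj L) 3).quotFun (truncation ν 𝓕 T (eisensteinSeriesU (flatSectionU φ z)))))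
    (hFtube₂ : (∀ z ∈ D₂, 2 < z.re → ((F z : Lp ℂ 2 μ) : (quasiSplit (↥(maximalRealSubfield L)) L (IsCMField.complexConj L) 3).automorphicQuotient → ℂ) =ᵐ[μ] (quasiSplit (↥(maximalRealSubfield L)) L (IsCMField.complexConj L) 3).quotFun (truncation ν 𝓕 T (eisensteinSeriesU (flatSectionU φ z)))))
    -- (L2) the continued scalars: holomorphy on the domains and agreement with the intertwining integrals on the tube
    {wc : ℂ → ℂ} (hwc₁ : DifferentiableOn ℂ wc D₁) (hwc₂ : DifferentiableOn ℂ wc D₂)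
    (hwagree : ∀ s : ℂ, 2 < s.re → wc s = ∫ x in {x : (AdeleRing (𝓞 L) L)ˣ | (IdeleClassGroup.ideleNorm L x : ℝ) ≤ 1} ∩ 𝓕I, ((IdeleClassGroup.ideleNorm L x : ℝ) : ℂ) * (((reflectChar (IsCMField.complexConj L) χ₁ x : ℂˣ) : ℂ) * conj ((χ₁ x : ℂˣ) : ℂ) * (∫ k, (fun g : (quasiSplit (↥(maximalRealSubfield L)) L (IsCMField.complexConj L) 3).Adelic => (∫ v : ↥(adelicUnipotent (↥(maximalRealSubfield L)) L (IsCMField.complexConj L) 3), flatSectionU φ s ((quasiSplit (↥(maximalRealSubfield L)) L (IsCMField.complexConj L) 3).toAdelic (weylLongU ((IsCMField.complexConj L : L ≃ₐ[↥(maximalRealSubfield L)] L) : L →+* L) (rfl : (StdForm.antidiagonal 3).over L = (StdForm.antidiagonal 3).over L)) * ((v : (quasiSplit (↥(maximalRealSubfield L)) L (IsCMField.complexConj L) 3).Adelic) * g)) ∂ν) * ((borelHeight g : ℝ) : ℂ) ^ (s - 2)) (k : (quasiSplit (↥(maximalRealSubfield L)) L (IsCMField.complexConj L) 3).Adelic)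 * conj (φ (k : (quasiSplit (↥(maximalRealSubfield L)) L (IsCMField.complexConj L) 3).Adelic)) ∂μK)) ∂νI)
    {Bc : ℂ → ℂ → ℂ} (hBc₁ : ∀ z' ∈ D₁, DifferentiableOn ℂ (fun z : ℂ => Bc z z') D₁) (hBc₂ : ∀ z ∈ D₁, DifferentiableOn ℂ (fun u : ℂ => Bc z (conj u)) {u : ℂ | conj u ∈ D₁})
    (hBc₁' : ∀ z' ∈ D₂, DifferentiableOn ℂ (fun z : ℂ => Bc z z') D₂) (hBc₂' : ∀ z ∈ D₂, DifferentiableOn ℂ (fun u : ℂ => Bc z (conj u)) {u : ℂ | conj u ∈ D₂})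
    (hBagree : ∀ s s' : ℂ, 2 < s.re → 2 < s'.re → Bc s s' = (∫ x in {x : (AdeleRing (𝓞 L) L)ˣ | (IdeleClassGroup.ideleNorm L x : ℝ) ≤ 1} ∩ 𝓕I, ((IdeleClassGroup.ideleNorm L x : ℝ) : ℂ) ∂νI) * (∫ k, (fun g : (quasiSplit (↥(maximalRealSubfield L)) L (IsCMField.complexConj L) 3).Adelic => (∫ v : ↥(adelicUnipotent (↥(maximalRealSubfield L)) L (IsCMField.complexConj L) 3), flatSectionU φ s ((quasiSplit (↥(maximalRealSubfield L)) L (IsCMField.complexConj L) 3).toAdelic (weylLongU ((IsCMField.complexConj L : L ≃ₐ[↥(maximalRealSubfield L)] L) : L →+* L) (rfl : (StdForm.antidiagonal 3).over L = (StdForm.antidiagonal 3).over L)) * ((v : (quasiSplit (↥(maximalRealSubfield L)) L (IsCMField.complexConj L) 3).Adelic) * g)) ∂ν) * ((borelHeight g : ℝ) : ℂ) ^ (s - 2)) (k : (quasiSplit (↥(maximalRealSubfield L)) L (IsCMField.complexConj L) 3).Adelic) * conj ((fun g : (quasiSplit (↥(maximalRealSubfield L)) L (IsCMField.complexConj L)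 3).Adelic => (∫ v : ↥(adelicUnipotent (↥(maximalRealSubfield L)) L (IsCMField.complexConj L) 3), flatSectionU φ s' ((quasiSplit (↥(maximalRealSubfield L)) L (IsCMField.complexConj L) 3).toAdelic (weylLongU ((IsCMField.complexConj L : L ≃ₐ[↥(maximalRealSubfield L)] L) : L →+* L) (rfl : (StdForm.antidiagonal 3).over L = (StdForm.antidiagonal 3).over L)) * ((v : (quasiSplit (↥(maximalRealSubfield L)) L (IsCMField.complexConj L) 3).Adelic) * g)) ∂ν) * ((borelHeight g : ℝ) : ℂ) ^ (s' - 2)) (k : (quasiSplit (↥(maximalRealSubfield L)) L (IsCMField.complexConj L) 3).Adelic)) ∂μK))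
    -- (L3) the pole data at `3∕2`
    {d : ℂ → ℂ} (hd : AnalyticAt ℂ d (3 / 2 : ℂ)) (hdw : ∀ᶠ z in 𝓝[≠] ((3 / 2 : ℂ)), d z = (z - 3 / 2) * wc z)
    (hreal : ∀ᶠ x : ℝ in 𝓝[≠] (3 / 2 : ℝ), (wc (x : ℂ)).im = 0)
    (hβB : ∃ B : ℝ, ∀ᶠ z in 𝓝[≠] ((3 / 2 : ℂ)), ‖z - 3 / 2‖ ^ 2 * ‖Bc z z‖ ≤ B) :
    ∃ C : ℝ, ∀ᶠ z in 𝓝[≠] ((3 / 2 : ℂ)), ‖(z - 3 / 2) • F z‖ ≤ C := by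
  have hT0 : (0 : ℝ) < (T : ℝ) := by exact_mod_cast (zero_lt_one.trans_le hT)
  have h32 : (((3 / 2 : ℝ)) : ℂ) = 3 / 2 := by push_cast; ring
  obtain ⟨Cμ, CK, _, _, h⟩ := Summit.HodgeConjecture.HodgeConjecture.Cruxes.H413.K2E1ChiMaassSelbergTubeFreeCMThree.maassSelberg_chiPair_cm_three_self_free L μ νG μK νI h𝓕I ν h𝓕N h𝓕1 h𝓕c
  have hU : ∀ {D : Set ℂ}, (∀ z ∈ D, 2 < z.re → ((F z : Lp ℂ 2 μ) : (quasiSplit (↥(maximalRealSubfield L)) L (IsCMField.complexConj L) 3).automorphicQuotient → ℂ) =ᵐ[μ] (quasiSplit (↥(maximalRealSubfield L)) L (IsCMField.complexConj L) 3).quotFun (truncation ν 𝓕 T (eisensteinSeriesU (flatSectionU φ z)))) →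
      ∀ z ∈ D, ∀ z' ∈ D, 2 < z'.re → z'.re < z.re →
      ⟪F z', F z⟫_ℂ = ((Cμ : ℝ) : ℂ) * (((CK : ℝ) : ℂ) *
        ((((T : ℝ) : ℂ) ^ (z + conj z' - 2) / (z + conj z' - 2)) * ((((∫ x in {x : (AdeleRing (𝓞 L) L)ˣ | (IdeleClassGroup.ideleNorm L x : ℝ) ≤ 1} ∩ 𝓕I, (IdeleClassGroup.ideleNorm L x : ℝ) ∂νI) * (∫ k, ‖φ (k : (quasiSplit (↥(maximalRealSubfield L)) L (IsCMField.complexConj L) 3).Adelic)‖ ^ 2 ∂μK)) : ℝ) : ℂ)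
          + (((T : ℝ) : ℂ) ^ (z - conj z') / (z - conj z')) * conj (∫ x in {x : (AdeleRing (𝓞 L) L)ˣ | (IdeleClassGroup.ideleNorm L x : ℝ) ≤ 1} ∩ 𝓕I, ((IdeleClassGroup.ideleNorm L x : ℝ) : ℂ) * (((reflectChar (IsCMField.complexConj L) χ₁ x : ℂˣ) : ℂ) * conj ((χ₁ x : ℂˣ) : ℂ) * (∫ k, (fun g : (quasiSplit (↥(maximalRealSubfield L)) L (IsCMField.complexConj L) 3).Adelic => (∫ v : ↥(adelicUnipotent (↥(maximalRealSubfield L)) L (IsCMField.complexConj L) 3), flatSectionU φ z' ((quasiSplit (↥(maximalRealSubfield L)) L (IsCMField.complexConj L) 3).toAdelic (weylLongU ((IsCMField.complexConj L : L ≃ₐ[↥(maximalRealSubfield L)] L) : L →+* L) (rfl : (StdForm.antidiagonal 3).over L = (StdForm.antidiagonal 3).over L)) * ((v : (quasiSplit (↥(maximalRealSubfield L)) L (IsCMField.complexConj L) 3).Adelic) * g)) ∂ν) * ((borelHeight g : ℝ) : ℂ) ^ (z' - 2)) (k : (quasiSplit (↥(maximalRealSubfield L)) L (IsCMField.complexConj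 L) 3).Adelic) * conj (φ (k : (quasiSplit (↥(maximalRealSubfield L)) L (IsCMField.complexConj L) 3).Adelic)) ∂μK)) ∂νI)
          - (((T : ℝ) : ℂ) ^ (-(z - conj z')) / (z - conj z')) * (∫ x in {x : (AdeleRing (𝓞 L) L)ˣ | (IdeleClassGroup.ideleNorm L x : ℝ) ≤ 1} ∩ 𝓕I, ((IdeleClassGroup.ideleNorm L x : ℝ) : ℂ) * (((reflectChar (IsCMField.complexConj L) χ₁ x : ℂˣ) : ℂ) * conj ((χ₁ x : ℂˣ) : ℂ) * (∫ k, (fun g : (quasiSplit (↥(maximalRealSubfield L)) L (IsCMField.complexConj L) 3).Adelic => (∫ v : ↥(adelicUnipotent (↥(maximalRealSubfield L)) L (IsCMField.complexConj L) 3), flatSectionU φ z ((quasiSplit (↥(maximalRealSubfield L)) L (IsCMField.complexConj L) 3).toAdelic (weylLongU ((IsCMField.complexConj L : L ≃ₐ[↥(maximalRealSubfield L)] L) : L →+* L) (rfl : (StdForm.antidiagonal 3).over L = (StdForm.antidiagonal 3).over L)) * ((v : (quasiSplit (↥(maximalRealSubfield L)) L (IsCMField.complexConj L) 3).Adelic)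 * g)) ∂ν) * ((borelHeight g : ℝ) : ℂ) ^ (z - 2)) (k : (quasiSplit (↥(maximalRealSubfield L)) L (IsCMField.complexConj L) 3).Adelic) * conj (φ (k : (quasiSplit (↥(maximalRealSubfield L)) L (IsCMField.complexConj L) 3).Adelic)) ∂μK)) ∂νI)
          - (((T : ℝ) : ℂ) ^ (-(z + conj z' - 2)) / (z + conj z' - 2)) * ((∫ x in {x : (AdeleRing (𝓞 L) L)ˣ | (IdeleClassGroup.ideleNorm L x : ℝ) ≤ 1} ∩ 𝓕I, ((IdeleClassGroup.ideleNorm L x : ℝ) : ℂ) ∂νI) * (∫ k, (fun g : (quasiSplit (↥(maximalRealSubfield L)) L (IsCMField.complexConj L) 3).Adelic => (∫ v : ↥(adelicUnipotent (↥(maximalRealSubfield L)) L (IsCMField.complexConj L) 3), flatSectionU φ z ((quasiSplit (↥(maximalRealSubfield L)) L (IsCMField.complexConj L) 3).toAdelic (weylLongU ((IsCMField.complexConj L : L ≃ₐ[↥(maximalRealSubfield L)] L) : L →+* L) (rfl : (StdForm.antidiagonal 3).over L = (StdForm.antidiagonal 3).over L)) * ((v : (quasiSplit (↥(maximalRealSubfield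 L)) L (IsCMField.complexConj L) 3).Adelic) * g)) ∂ν) * ((borelHeight g : ℝ) : ℂ) ^ (z - 2)) (k : (quasiSplit (↥(maximalRealSubfield L)) L (IsCMField.complexConj L) 3).Adelic) * conj ((fun g : (quasiSplit (↥(maximalRealSubfield L)) L (IsCMField.complexConj L) 3).Adelic => (∫ v : ↥(adelicUnipotent (↥(maximalRealSubfield L)) L (IsCMField.complexConj L) 3), flatSectionU φ z' ((quasiSplit (↥(maximalRealSubfield L)) L (IsCMField.complexConj L) 3).toAdelic (weylLongU ((IsCMField.complexConj L : L ≃ₐ[↥(maximalRealSubfield L)] L) : L →+* L) (rfl : (StdForm.antidiagonal 3).over L = (StdForm.antidiagonal 3).over L)) * ((v : (quasiSplit (↥(maximalRealSubfield L)) L (IsCMField.complexConj L) 3).Adelic) * g)) ∂ν) * ((borelHeight g : ℝ) : ℂ) ^ (z' - 2)) (k : (quasiSplit (↥(maximalRealSubfield L)) L (IsCMField.complexConj L) 3).Adelic)) ∂μK)))) := by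
    intro D hFt z hz z' hz' h1 h2
    have hraw : ⟪F z', F z⟫_ℂ = ∫ x, (quasiSplit (↥(maximalRealSubfield L)) L (IsCMField.complexConj L) 3).quotFun (truncation ν 𝓕 T (eisensteinSeriesU (flatSectionU φ z))) x * conj ((quasiSplit (↥(maximalRealSubfield L)) L (IsCMField.complexConj L) 3).quotFun (truncation ν 𝓕 T (eisensteinSeriesU (flatSectionU φ z'))) x) ∂μ := by
      rw [MeasureTheory.L2.inner_def]
      refine integral_congr_ae ?_
      filter_upwards [hFt z hz (h1.trans h2), hFt z' hz' h1] with x hx hx'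
      rw [hx, hx', RCLike.inner_apply, mul_comm]
    have key := h hβ hT hχ₁ hρ₁ hχ₂u hχ₂ hφc hφ hφC hφc hφ hφC h1 h2
    rw [hraw, key]
    have hA : (∫ x in {x : (AdeleRing (𝓞 L) L)ˣ | (IdeleClassGroup.ideleNorm L x : ℝ) ≤ 1} ∩ 𝓕I, ((IdeleClassGroup.ideleNorm L x : ℝ) : ℂ) ∂νI) * (∫ k, φ (k : (quasiSplit (↥(maximalRealSubfield L)) L (IsCMField.complexConj L) 3).Adelic) * conj (φ (k : (quasiSplit (↥(maximalRealSubfield L)) L (IsCMField.complexConj L) 3).Adelic)) ∂μK) = ((((∫ x in {x : (AdeleRing (𝓞 L) L)ˣ | (IdeleClassGroup.ideleNorm L x : ℝ) ≤ 1} ∩ 𝓕I, (IdeleClassGroup.ideleNorm L x : ℝ) ∂νI) * (∫ k, ‖φ (k : (quasiSplit (↥(maximalRealSubfield L)) L (IsCMField.complexConj L) 3).Adelic)‖ ^ 2 ∂μK)) : ℝ) : ℂ) := by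
      have e1 : (∫ x in {x : (AdeleRing (𝓞 L) L)ˣ | (IdeleClassGroup.ideleNorm L x : ℝ) ≤ 1} ∩ 𝓕I, ((IdeleClassGroup.ideleNorm L x : ℝ) : ℂ) ∂νI) = (((∫ x in {x : (AdeleRing (𝓞 L) L)ˣ | (IdeleClassGroup.ideleNorm L x : ℝ) ≤ 1} ∩ 𝓕I, (IdeleClassGroup.ideleNorm L x : ℝ) ∂νI) : ℝ) : ℂ) := integral_complex_ofReal
      have e2 : (∫ k, φ (k : (quasiSplit (↥(maximalRealSubfield L)) L (IsCMField.complexConj L) 3).Adelic) * conj (φ (k : (quasiSplit (↥(maximalRealSubfield L)) L (IsCMField.complexConj L) 3).Adelic)) ∂μK) = (((∫ k, ‖φ (k : (quasiSplit (↥(maximalRealSubfield L)) L (IsCMField.complexConj L) 3).Adelic)‖ ^ 2 ∂μK) : ℝ) : ℂ) := by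
        rw [← integral_complex_ofReal]
        refine integral_congr_ae (Filter.Eventually.of_forall fun k => ?_)
        dsimp only
        rw [Complex.mul_conj, Complex.normSq_eq_norm_sq, Complex.ofReal_pow]
      rw [e1, e2, ← Complex.ofReal_mul]
    have hP : conj (∫ k, (fun g : (quasiSplit (↥(maximalRealSubfield L)) L (IsCMField.complexConj L) 3).Adelic => (∫ v : ↥(adelicUnipotent (↥(maximalRealSubfield L)) L (IsCMField.complexConj L) 3), flatSectionU φ z' ((quasiSplit (↥(maximalRealSubfield L)) L (IsCMField.complexConj L) 3).toAdelic (weylLongU ((IsCMField.complexConj L : L ≃ₐ[↥(maximalRealSubfield L)] L) : L →+* L) (rfl : (StdForm.antidiagonal 3).over L = (StdForm.antidiagonal 3).over L)) * ((v : (quasiSplit (↥(maximalRealSubfield L)) L (IsCMField.complexConj L) 3).Adelic) * g)) ∂ν) * ((borelHeight g : ℝ) : ℂ) ^ (z' - 2)) (k : (quasiSplit (↥(maximalRealSubfield L)) L (IsCMField.complexConj L) 3).Adelic) * conj (φ (k : (quasiSplit (↥(maximalRealSubfield L)) L (IsCMField.complexConj L) 3).Adelic)) ∂μK) = (∫ k,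 φ (k : (quasiSplit (↥(maximalRealSubfield L)) L (IsCMField.complexConj L) 3).Adelic) * conj ((fun g : (quasiSplit (↥(maximalRealSubfield L)) L (IsCMField.complexConj L) 3).Adelic => (∫ v : ↥(adelicUnipotent (↥(maximalRealSubfield L)) L (IsCMField.complexConj L) 3), flatSectionU φ z' ((quasiSplit (↥(maximalRealSubfield L)) L (IsCMField.complexConj L) 3).toAdelic (weylLongU ((IsCMField.complexConj L : L ≃ₐ[↥(maximalRealSubfield L)] L) : L →+* L) (rfl : (StdForm.antidiagonal 3).over L = (StdForm.antidiagonal 3).over L)) * ((v : (quasiSplit (↥(maximalRealSubfield L)) L (IsCMField.complexConj L) 3).Adelic) * g)) ∂ν) * ((borelHeight g : ℝ) : ℂ) ^ (z' - 2)) (k : (quasiSplit (↥(maximalRealSubfield L)) L (IsCMField.complexConj L) 3).Adelic)) ∂μK) := by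
      rw [← integral_conj]
      refine integral_congr_ae (Filter.Eventually.of_forall fun k => ?_)
      dsimp only
      rw [map_mul, Complex.conj_conj, mul_comm]
    have hB : (∫ x in {x : (AdeleRing (𝓞 L) L)ˣ | (IdeleClassGroup.ideleNorm L x : ℝ) ≤ 1} ∩ 𝓕I, ((IdeleClassGroup.ideleNorm L x : ℝ) : ℂ) * (((χ₁ x : ℂˣ) : ℂ) * conj ((reflectChar (IsCMField.complexConj L) χ₁ x : ℂˣ) : ℂ) * (∫ k, φ (k : (quasiSplit (↥(maximalRealSubfield L)) L (IsCMField.complexConj L) 3).Adelic) * conj ((fun g : (quasiSplit (↥(maximalRealSubfield L)) L (IsCMField.complexConj L) 3).Adelic => (∫ v : ↥(adelicUnipotent (↥(maximalRealSubfield L)) L (IsCMField.complexConj L) 3), flatSectionU φ z' ((quasiSplit (↥(maximalRealSubfield L)) L (IsCMField.complexConj L) 3).toAdelic (weylLongU ((IsCMField.complexConj L : L ≃ₐ[↥(maximalRealSubfield L)] L) : L →+* L) (rfl : (StdForm.antidiagonal 3).over L = (StdForm.antidiagonal 3).over L)) * ((v : (quasiSplit (↥(maximalRealSubfield L)) L (IsCMField.complexConj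 L) 3).Adelic) * g)) ∂ν) * ((borelHeight g : ℝ) : ℂ) ^ (z' - 2)) (k : (quasiSplit (↥(maximalRealSubfield L)) L (IsCMField.complexConj L) 3).Adelic)) ∂μK)) ∂νI) = conj (∫ x in {x : (AdeleRing (𝓞 L) L)ˣ | (IdeleClassGroup.ideleNorm L x : ℝ) ≤ 1} ∩ 𝓕I, ((IdeleClassGroup.ideleNorm L x : ℝ) : ℂ) * (((reflectChar (IsCMField.complexConj L) χ₁ x : ℂˣ) : ℂ) * conj ((χ₁ x : ℂˣ) : ℂ) * (∫ k, (fun g : (quasiSplit (↥(maximalRealSubfield L)) L (IsCMField.complexConj L) 3).Adelic => (∫ v : ↥(adelicUnipotent (↥(maximalRealSubfield L)) L (IsCMField.complexConj L) 3), flatSectionU φ z' ((quasiSplit (↥(maximalRealSubfield L)) L (IsCMField.complexConj L) 3).toAdelic (weylLongU ((IsCMField.complexConj L : L ≃ₐ[↥(maximalRealSubfield L)] L) : L →+* L) (rfl : (StdForm.antidiagonal 3).over L = (StdForm.antidiagonal 3).over L)) * ((v : (quasiSplit (↥(maximalRealSubfield L)) L (IsCMField.complexConj L) 3).Adelic) *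 g)) ∂ν) * ((borelHeight g : ℝ) : ℂ) ^ (z' - 2)) (k : (quasiSplit (↥(maximalRealSubfield L)) L (IsCMField.complexConj L) 3).Adelic) * conj (φ (k : (quasiSplit (↥(maximalRealSubfield L)) L (IsCMField.complexConj L) 3).Adelic)) ∂μK)) ∂νI) := by
      rw [← integral_conj]
      refine integral_congr_ae (Filter.Eventually.of_forall fun x => ?_)
      simp only [map_mul, Complex.conj_ofReal, Complex.conj_conj, hP]
      ring
    rw [hA, hB]
  have hMStube : ∀ {D : Set ℂ}, (∀ z ∈ D, 2 < z.re → ((F z : Lp ℂ 2 μ) : (quasiSplit (↥(maximalRealSubfield L)) L (IsCMField.complexConj L) 3).automorphicQuotient → ℂ) =ᵐ[μ] (quasiSplit (↥(maximalRealSubfield L)) L (IsCMField.complexConj L) 3).quotFun (truncation ν 𝓕 T (eisensteinSeriesU (flatSectionU φ z)))) →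
      ∀ z ∈ D, ∀ z' ∈ D, 2 < z'.re → z'.re < z.re →
      ⟪F z', F z⟫_ℂ = ((Cμ : ℝ) : ℂ) * (((CK : ℝ) : ℂ) *
        ((((T : ℝ) : ℂ) ^ (z + conj z' - 2) / (z + conj z' - 2)) * ((((∫ x in {x : (AdeleRing (𝓞 L) L)ˣ | (IdeleClassGroup.ideleNorm L x : ℝ) ≤ 1} ∩ 𝓕I, (IdeleClassGroup.ideleNorm L x : ℝ) ∂νI) * (∫ k, ‖φ (k : (quasiSplit (↥(maximalRealSubfield L)) L (IsCMField.complexConj L) 3).Adelic)‖ ^ 2 ∂μK)) : ℝ) : ℂ)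
          + (((T : ℝ) : ℂ) ^ (z - conj z') / (z - conj z')) * conj (wc z')
          - (((T : ℝ) : ℂ) ^ (-(z - conj z')) / (z - conj z')) * wc z
          - (((T : ℝ) : ℂ) ^ (-(z + conj z' - 2)) / (z + conj z' - 2)) * Bc z z')) := by
    intro D hFt z hz z' hz' h1 h2
    rw [hU hFt z hz z' hz' h1 h2, hwagree z (h1.trans h2), hwagree z' h1, hBagree z z' (h1.trans h2) h1]
  have hrel := Summit.HodgeConjecture.HodgeConjecture.Cruxes.H413.K2E1ChiMaassSelbergDiagonalCMThree.msRel_of_tube_letters (3 / 2 : ℝ) hD₁ hD₁c hD₁sub hO₁ hO₁ne hO₁D hO₂' hO₂'ne hO₂'D hsep hD₂ hD₂c hD₂sub hQ₁ hQ₁ne hQ₁D hQ₂' hQ₂'ne hQ₂'D hsep₂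
    (by rw [h32]; exact hD₁ev) (by rw [h32]; exact hD₂ev) Cμ CK ((∫ x in {x : (AdeleRing (𝓞 L) L)ˣ | (IdeleClassGroup.ideleNorm L x : ℝ) ≤ 1} ∩ 𝓕I, (IdeleClassGroup.ideleNorm L x : ℝ) ∂νI) * (∫ k, ‖φ (k : (quasiSplit (↥(maximalRealSubfield L)) L (IsCMField.complexConj L) 3).Adelic)‖ ^ 2 ∂μK)) hT0 hwc₁ hwc₂ hBc₁ hBc₂ hBc₁' hBc₂' F hFd₁ hFd₂ (hMStube hFtube₁) (hMStube hFtube₂)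
  rw [h32] at hrel
  exact Summit.HodgeConjecture.HodgeConjecture.Cruxes.H413.K2E1ChiEisensteinL2BoundMiddlePoleCMThree.msBound_middlePole_of_chiRelation F hV hVmem hFc Cμ CK ((∫ x in {x : (AdeleRing (𝓞 L) L)ˣ | (IdeleClassGroup.ideleNorm L x : ℝ) ≤ 1} ∩ 𝓕I, (IdeleClassGroup.ideleNorm L x : ℝ) ∂νI) * (∫ k, ‖φ (k : (quasiSplit (↥(maximalRealSubfield L)) L (IsCMField.complexConj L) 3).Adelic)‖ ^ 2 ∂μK)) hT0 (w := wc) (d := d) (β := fun z => Bc z z) hd hdw hreal hβB hrel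

end Free

/-- **§0b. THE MID-BLOCK CHARACTER `ξ.bcη⁻¹ · ξ.bcψ⁻¹ · μω` IS TRIVIAL ON THE POSITIVE REAL IDELES** when `μω` restricts to `ε_{L∕L⁺}` on `𝔸_{L⁺}^×` (the socket's `hquad`): `z_L(t) = z_{L⁺}(t)_L`
(★ `AdeleRing.ideleBaseChange_posRealIdele`), `bcη`, `bcψ` are trivial on `𝔸_{L⁺}^×` (★ `bcη_ideleBaseChange`, ★ `bcψ_ideleBaseChange`), `ε² = 1` (★ `quadraticHeckeCharCM_sq`) kills `z_{L⁺}(t) =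
z_{L⁺}(√t)²` — ★ p863403's binder `hρ₁` at the block character (pattern of ★ `bcηInv_mul_posRealIdele`). [cite: Rogawski1990, §12.1 p. 171, §12.2 p. 174] -/
theorem midBlockChar_posRealIdele (L : Type) [Field L] [NumberField L] [IsCMField L] (ξ : OneDimAutRepH L) (μω : HeckeCharacter L)
    (hμω : (∀ x : Literature.NumberTheory.GaloisRepresentations.ideleGroup ↥(maximalRealSubfield L), μω (AdeleRing.ideleBaseChange (↥(maximalRealSubfield L)) L x) = quadraticHeckeCharCM L x)) (t : ℝ≥0ˣ) :
    (ξ.bcη⁻¹ * ξ.bcψ⁻¹ * μω) (posRealIdele L t) = 1 := by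
  have hsq : ∀ s : ℝ≥0ˣ, quadraticHeckeCharCM L (posRealIdele ↥(maximalRealSubfield L) s) = 1 := fun s => by
    set u : ℝ≥0ˣ := Units.mk0 (NNReal.sqrt (s : ℝ≥0)) (by rw [Ne, NNReal.sqrt_eq_zero]; exact s.ne_zero) with hu
    have hsu : s = u * u := by
      ext
      simp [hu, NNReal.mul_self_sqrt]
    rw [hsu, map_mul, map_mul, ← HeckeCharacter.mul_apply, ← pow_two, quadraticHeckeCharCM_sq L, HeckeCharacter.one_apply]
  rw [← AdeleRing.ideleBaseChange_posRealIdele (↥(maximalRealSubfield L)) L t, HeckeCharacter.mul_apply, HeckeCharacter.mul_apply, HeckeCharacter.inv_apply,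
    HeckeCharacter.inv_apply, OneDimAutRepH.bcη_ideleBaseChange, OneDimAutRepH.bcψ_ideleBaseChange, hμω, hsq]
  simp only [inv_one, one_mul]

section OneGenerator
variable (L : Type) [Field L] [NumberField L] [IsCMField L]
  [MeasurableSpace (quasiSplit (↥(maximalRealSubfield L)) L (IsCMField.complexConj L) 3).Adelic] [BorelSpace (quasiSplit (↥(maximalRealSubfield L)) L (IsCMField.complexConj L) 3).Adelic]
  [MeasurableSpace (AdeleRing (𝓞 L) L)ˣ] [BorelSpace (AdeleRing (𝓞 L) L)ˣ]
  (μ : Measure (quasiSplit (↥(maximalRealSubfield L)) L (IsCMField.complexConj L) 3).automorphicQuotient) [(quasiSplit (↥(maximalRealSubfield L)) L (IsCMField.complexConj L) 3).IsAutomorphicMeasure μ]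
  (ξ : OneDimAutRepH L) (μω : HeckeCharacter L)

/-- **§1. THE ROAD PACKAGE OF ONE GENERATOR FROM THE BARE CONTINUATION AND THE CONTINUED SCALARS** (normalised Heisenberg package: `ν 𝓕 = 1`, `ν` inversion-invariant).  In: `hμu`,
`hquad`; D1's clauses (`φ` in the mid-block pair space, continuous; `Ec` with real singular set `Sp`, `= E(φ_z)` on `{2<Re}`); CONT DATA `(T ≥ 1, S ⊂ ℝ finite, Fam)` holomorphic on `D :=
{1<Re} ∖ (Sp ∪ S)` with `Fam z =ᵐ Λ^T Ec z` there; SCAT DATA (∀ Haar `μ_K`, Haar `ν_I`, idele class domain `𝓕_I`: continued scalars `wc, Bc` on the quarter planes agreeing with the intertwining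
pairings on the tube, pole data `d, hdw, hreal, hβB`).  Out: ★ p863422's ROAD package — `D` open, PRECONNECTED (★ `isPathConnected_convex_diff_finite`), `⊆ {1<Re}∖Sp`, `σ₀ := 3 + Σ|Re s|`
and punctured `3∕2` inside, `hFam`, and `hMS` by §0 (structural data CHOSEN: `haar` ×3, ★ `isInvInvariant_of_isHaarMeasure_cm_three`, ★ `exists_isIdeleClassDomain`, ★
`exists_isCoveringWeight_arithmeticBorel`; section data ★ `isUnitary_midBlockChar`, §0b, `ξ.unit_ψ`, `ξ.hψ`, `isChiSectionPair_of_mem`, `exists_bound_of_mem_chiSectionSpacePair_midBlock`).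
[cite: MoeglinWaldspurger1995, IV.2.3, IV.3.12 (a)] [cite: Arthur1980TraceFormulaII, §4] [cite: Langlands1976, §7] -/
theorem roadData_of_tubeLetters (hμu : μω.IsUnitary) (hquad : (∀ x : Literature.NumberTheory.GaloisRepresentations.ideleGroup ↥(maximalRealSubfield L), μω (AdeleRing.ideleBaseChange (↥(maximalRealSubfield L)) L x) = quadraticHeckeCharCM L x))
    {K' : Subgroup (quasiSplit (↥(maximalRealSubfield L)) L (IsCMField.complexConj L) 3).Adelic} {ω : ↥K' →* ℂ}
    {φ : (quasiSplit (↥(maximalRealSubfield L)) L (IsCMField.complexConj L) 3).Adelic → ℂ} (hφV : φ ∈ chiSectionSpacePair (ξ.bcη⁻¹ * ξ.bcψ⁻¹ * μω) ξ.ψ K' (ω : ↥K' → ℂ)) (hφc : Continuous φ)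
    (Ec : ℂ → (quasiSplit (↥(maximalRealSubfield L)) L (IsCMField.complexConj L) 3).Adelic → ℂ) {Sp : Finset ℂ} (hSp : ∀ s ∈ Sp, s.im = 0 ∧ 1 < s.re ∧ s.re ≤ 2)
    (hEis : ∀ z : ℂ, 2 < z.re → Ec z = eisensteinSeriesU (flatSectionU φ z))
    (ν : Measure ↥(adelicUnipotent (↥(maximalRealSubfield L)) L (IsCMField.complexConj L) 3)) [ν.IsHaarMeasure] [ν.IsInvInvariant] {𝓕 : Set ↥(adelicUnipotent (↥(maximalRealSubfield L)) L (IsCMField.complexConj L) 3)} (h𝓕N : IsFundamentalDomain ↥(rationalUnipotent (↥(maximalRealSubfield L)) L (IsCMField.complexConj L) 3) 𝓕 ν) (h𝓕1 : ν 𝓕 = 1)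
    (h𝓕c : IsCompact (closure 𝓕))
    -- CONT data
    {T : ℝ≥0} (hT : 1 ≤ T) {S : Finset ℂ} (hS : ∀ s ∈ S, s.im = 0) (Fam : ℂ → (quasiSplit (↥(maximalRealSubfield L)) L (IsCMField.complexConj L) 3).L2 μ)
    (hFd : DifferentiableOn ℂ Fam ({z : ℂ | 1 < z.re} \ (↑(Sp ∪ S) : Set ℂ)))
    (hFam : ∀ z ∈ ({z : ℂ | 1 < z.re} \ (↑(Sp ∪ S) : Set ℂ)), ((Fam z : (quasiSplit (↥(maximalRealSubfield L)) L (IsCMField.complexConj L) 3).L2 μ) : (quasiSplit (↥(maximalRealSubfield L)) L (IsCMField.complexConj L) 3).automorphicQuotient → ℂ) =ᵐ[μ] (quasiSplit (↥(maximalRealSubfield L)) L (IsCMField.complexConj L) 3).quotFun (truncation ν 𝓕 T (Ec z)))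
    -- SCAT data
    (hscat : ∀ (μK : Measure ↥((standardMaximalCompactGL 3 L).comap (adelicVal (↥(maximalRealSubfield L)) L (IsCMField.complexConj L) 3 ((StdForm.antidiagonal 3).over L)) : Subgroup (quasiSplit (↥(maximalRealSubfield L)) L (IsCMField.complexConj L) 3).Adelic)) (_ : μK.IsHaarMeasure) (νI : Measure (AdeleRing (𝓞 L) L)ˣ) (_ : νI.IsHaarMeasure) (𝓕I : Set (AdeleRing (𝓞 L) L)ˣ) (_ : IsIdeleClassDomain L 𝓕I),
        ∃ (wc : ℂ → ℂ) (Bc : ℂ → ℂ → ℂ) (d : ℂ → ℂ),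
          DifferentiableOn ℂ wc {z : ℂ | 1 < z.re ∧ 0 < z.im} ∧ DifferentiableOn ℂ wc {z : ℂ | 1 < z.re ∧ z.im < 0} ∧ (∀ s : ℂ, 2 < s.re → wc s = ∫ x in {x : (AdeleRing (𝓞 L) L)ˣ | (IdeleClassGroup.ideleNorm L x : ℝ) ≤ 1} ∩ 𝓕I, ((IdeleClassGroup.ideleNorm L x : ℝ) : ℂ) * (((reflectChar (IsCMField.complexConj L) (ξ.bcη⁻¹ * ξ.bcψ⁻¹ * μω) x : ℂˣ) : ℂ) * conj (((ξ.bcη⁻¹ * ξ.bcψ⁻¹ * μω) x : ℂˣ) : ℂ) * (∫ k, (fun g : (quasiSplit (↥(maximalRealSubfield L)) L (IsCMField.complexConj L) 3).Adelic => (∫ v : ↥(adelicUnipotent (↥(maximalRealSubfield L)) L (IsCMField.complexConj L) 3), flatSectionU φ s ((quasiSplit (↥(maximalRealSubfield L)) L (IsCMField.complexConj L) 3).toAdelic (weylLongU ((IsCMField.complexConj L : L ≃ₐ[↥(maximalRealSubfield L)] L) : L →+* L) (rfl : (StdForm.antidiagonal 3).over L = (StdForm.antidiagonal 3).over L)) *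 ((v : (quasiSplit (↥(maximalRealSubfield L)) L (IsCMField.complexConj L) 3).Adelic) * g)) ∂ν) * ((borelHeight g : ℝ) : ℂ) ^ (s - 2)) (k : (quasiSplit (↥(maximalRealSubfield L)) L (IsCMField.complexConj L) 3).Adelic) * conj (φ (k : (quasiSplit (↥(maximalRealSubfield L)) L (IsCMField.complexConj L) 3).Adelic)) ∂μK)) ∂νI) ∧
          (∀ z' ∈ {z : ℂ | 1 < z.re ∧ 0 < z.im}, DifferentiableOn ℂ (fun z : ℂ => Bc z z') {z : ℂ | 1 < z.re ∧ 0 < z.im}) ∧ (∀ z ∈ {z : ℂ | 1 < z.re ∧ 0 < z.im}, DifferentiableOn ℂ (fun u : ℂ => Bc z (conj u)) {u : ℂ | conj u ∈ {z : ℂ | 1 < z.re ∧ 0 < z.im}}) ∧ (∀ z' ∈ {z : ℂ | 1 < z.re ∧ z.im < 0}, DifferentiableOn ℂ (fun z : ℂ => Bc z z') {z : ℂ | 1 < z.re ∧ z.im < 0}) ∧ (∀ z ∈ {z : ℂ | 1 < z.re ∧ z.im < 0}, DifferentiableOn ℂ (fun u : ℂ => Bc z (conj u)) {u : ℂ | conj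 u ∈ {z : ℂ | 1 < z.re ∧ z.im < 0}}) ∧ (∀ s s' : ℂ, 2 < s.re → 2 < s'.re → Bc s s' = (∫ x in {x : (AdeleRing (𝓞 L) L)ˣ | (IdeleClassGroup.ideleNorm L x : ℝ) ≤ 1} ∩ 𝓕I, ((IdeleClassGroup.ideleNorm L x : ℝ) : ℂ) ∂νI) * (∫ k, (fun g : (quasiSplit (↥(maximalRealSubfield L)) L (IsCMField.complexConj L) 3).Adelic => (∫ v : ↥(adelicUnipotent (↥(maximalRealSubfield L)) L (IsCMField.complexConj L) 3), flatSectionU φ s ((quasiSplit (↥(maximalRealSubfield L)) L (IsCMField.complexConj L) 3).toAdelic (weylLongU ((IsCMField.complexConj L : L ≃ₐ[↥(maximalRealSubfield L)] L) : L →+* L) (rfl : (StdForm.antidiagonal 3).over L = (StdForm.antidiagonal 3).over L)) * ((v : (quasiSplit (↥(maximalRealSubfield L)) L (IsCMField.complexConj L) 3).Adelic) * g)) ∂ν) * ((borelHeight g : ℝ) : ℂ) ^ (s - 2)) (k : (quasiSplit (↥(maximalRealSubfield L)) L (IsCMField.complexConj L) 3).Adelic) * conj ((fun g : (quasiSplit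 (↥(maximalRealSubfield L)) L (IsCMField.complexConj L) 3).Adelic => (∫ v : ↥(adelicUnipotent (↥(maximalRealSubfield L)) L (IsCMField.complexConj L) 3), flatSectionU φ s' ((quasiSplit (↥(maximalRealSubfield L)) L (IsCMField.complexConj L) 3).toAdelic (weylLongU ((IsCMField.complexConj L : L ≃ₐ[↥(maximalRealSubfield L)] L) : L →+* L) (rfl : (StdForm.antidiagonal 3).over L = (StdForm.antidiagonal 3).over L)) * ((v : (quasiSplit (↥(maximalRealSubfield L)) L (IsCMField.complexConj L) 3).Adelic) * g)) ∂ν) * ((borelHeight g : ℝ) : ℂ) ^ (s' - 2)) (k : (quasiSplit (↥(maximalRealSubfield L)) L (IsCMField.complexConj L) 3).Adelic)) ∂μK)) ∧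
          (AnalyticAt ℂ d (3 / 2 : ℂ)) ∧ (∀ᶠ z in 𝓝[≠] ((3 / 2 : ℂ)), d z = (z - 3 / 2) * wc z) ∧ (∀ᶠ x : ℝ in 𝓝[≠] (3 / 2 : ℝ), (wc (x : ℂ)).im = 0) ∧ (∃ B : ℝ, ∀ᶠ z in 𝓝[≠] ((3 / 2 : ℂ)), ‖z - 3 / 2‖ ^ 2 * ‖Bc z z‖ ≤ B)) :
    ∃ (T : ℝ≥0) (_ : 1 ≤ T) (D : Set ℂ) (σ₀ : ℝ) (Fam : ℂ → (quasiSplit (↥(maximalRealSubfield L)) L (IsCMField.complexConj L) 3).L2 μ),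
        IsOpen D ∧ IsPreconnected D ∧ D ⊆ ({z : ℂ | 1 < z.re} \ (↑Sp : Set ℂ)) ∧ DifferentiableOn ℂ Fam D ∧ 2 < σ₀ ∧ (∀ᶠ z in 𝓝 ((σ₀ : ℝ) : ℂ), z ∈ D) ∧ (∀ᶠ z in 𝓝[≠] ((3 : ℂ) / 2), z ∈ D) ∧
        (∀ z ∈ D, ((Fam z : (quasiSplit (↥(maximalRealSubfield L)) L (IsCMField.complexConj L) 3).L2 μ) : (quasiSplit (↥(maximalRealSubfield L)) L (IsCMField.complexConj L) 3).automorphicQuotient → ℂ) =ᵐ[μ] (quasiSplit (↥(maximalRealSubfield L)) L (IsCMField.complexConj L) 3).quotFun (truncation ν 𝓕 T (Ec z))) ∧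
        ∃ C : ℝ, ∀ᶠ z in 𝓝[≠] ((3 : ℂ) / 2), ‖(z - (3 : ℂ) / 2) • Fam z‖ ≤ C := by
  haveI := t2Space_adeleRing_of_numberField L
  haveI := locallyCompactSpace_adeleRing' L
  haveI : T2Space (quasiSplit (↥(maximalRealSubfield L)) L (IsCMField.complexConj L) 3).Adelic := inferInstanceAs (T2Space (adelic (↥(maximalRealSubfield L)) L (IsCMField.complexConj L) 3 ((StdForm.antidiagonal 3).over L)))
  haveI : LocallyCompactSpace (quasiSplit (↥(maximalRealSubfield L)) L (IsCMField.complexConj L) 3).Adelic := inferInstanceAs (LocallyCompactSpace (adelic (↥(maximalRealSubfield L)) L (IsCMField.complexConj L) 3 ((StdForm.antidiagonal 3).over L)))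
  haveI : CompactSpace ↥((standardMaximalCompactGL 3 L).comap (adelicVal (↥(maximalRealSubfield L)) L (IsCMField.complexConj L) 3 ((StdForm.antidiagonal 3).over L)) : Subgroup (quasiSplit (↥(maximalRealSubfield L)) L (IsCMField.complexConj L) 3).Adelic) := isCompact_iff_compactSpace.1 isCompact_comap_adelicVal_standardMaximalCompactGL
  obtain ⟨hI1, -, -⟩ := locallyCompactSpace_secondCountable_t2_idele (E := L)
  haveI := hI1
  haveI : (haar : Measure (quasiSplit (↥(maximalRealSubfield L)) L (IsCMField.complexConj L) 3).Adelic).IsInvInvariant :=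
    Summit.HodgeConjecture.HodgeConjecture.Cruxes.H413.K2E1SphericalEisensteinStructuralDataCMThree.isInvInvariant_of_isHaarMeasure_cm_three L haar
  obtain ⟨𝓕I, h𝓕I⟩ := exists_isIdeleClassDomain L
  obtain ⟨β, hβ⟩ := Summit.HodgeConjecture.HodgeConjecture.Cruxes.H413.K2E1BLEisensteinInWeightedSpaceU2.exists_isCoveringWeight_arithmeticBorel (F := ↥(maximalRealSubfield L)) (E := L) (c := IsCMField.complexConj L) (N := 3)
  obtain ⟨wc, Bc, d, hwc₁, hwc₂, hwagree, hBc₁, hBc₂, hBc₁', hBc₂', hBagree, hd, hdw, hreal, hβB⟩ :=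
    hscat (haar : Measure ↥((standardMaximalCompactGL 3 L).comap (adelicVal (↥(maximalRealSubfield L)) L (IsCMField.complexConj L) 3 ((StdForm.antidiagonal 3).over L)) : Subgroup (quasiSplit (↥(maximalRealSubfield L)) L (IsCMField.complexConj L) 3).Adelic)) inferInstance (haar : Measure (AdeleRing (𝓞 L) L)ˣ) inferInstance 𝓕I h𝓕I
  obtain ⟨Cφ, hφC⟩ := exists_bound_of_mem_chiSectionSpacePair_midBlock L ξ hμu hφV hφc
  have hDo : IsOpen ({z : ℂ | 1 < z.re} \ (↑(Sp ∪ S) : Set ℂ)) := (isOpen_lt continuous_const Complex.continuous_re).sdiff (Finset.finite_toSet _).isClosed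
  have hrealS : ∀ s ∈ Sp ∪ S, s.im = 0 := fun s hs => by
    rcases Finset.mem_union.1 hs with h | h
    exacts [(hSp s h).1, hS s h]
  have hDUP : {z : ℂ | 1 < z.re ∧ 0 < z.im} ⊆ ({z : ℂ | 1 < z.re} \ (↑(Sp ∪ S) : Set ℂ)) := fun z hz => ⟨hz.1, fun hmem => hz.2.ne' (hrealS z (Finset.mem_coe.1 hmem))⟩
  have hDLO : {z : ℂ | 1 < z.re ∧ z.im < 0} ⊆ ({z : ℂ | 1 < z.re} \ (↑(Sp ∪ S) : Set ℂ)) := fun z hz => ⟨hz.1, fun hmem => hz.2.ne (hrealS z (Finset.mem_coe.1 hmem))⟩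
  have hDsub : ({z : ℂ | 1 < z.re} \ (↑(Sp ∪ S) : Set ℂ)) ⊆ ({z : ℂ | 1 < z.re} \ (↑Sp : Set ℂ)) := Set.sdiff_subset_sdiff_right (Finset.coe_subset.2 Finset.subset_union_left)
  obtain ⟨σ₀, hσ₀, hσ₀D⟩ : ∃ σ₀ : ℝ, 2 < σ₀ ∧ ((σ₀ : ℝ) : ℂ) ∈ ({z : ℂ | 1 < z.re} \ (↑(Sp ∪ S) : Set ℂ)) := by
    have hsum : 0 ≤ ∑ s ∈ Sp ∪ S, |s.re| := Finset.sum_nonneg fun s _ => abs_nonneg _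
    refine ⟨3 + ∑ s ∈ Sp ∪ S, |s.re|, by linarith, show (1 : ℝ) < (((3 + ∑ s ∈ Sp ∪ S, |s.re| : ℝ)) : ℂ).re by rw [Complex.ofReal_re]; linarith, fun hmem => ?_⟩
    have h := Finset.single_le_sum (f := fun s : ℂ => |s.re|) (fun s _ => abs_nonneg s.re) (Finset.mem_coe.1 hmem)
    simp only [Complex.ofReal_re] at h
    linarith [le_abs_self (3 + ∑ s ∈ Sp ∪ S, |s.re|)]
  have h32 : (((3 / 2 : ℝ)) : ℂ) = (3 : ℂ) / 2 := by push_cast; ring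
  have hre : ∀ᶠ z : ℂ in 𝓝 ((3 : ℂ) / 2), 1 < z.re :=
    (isOpen_lt continuous_const Complex.continuous_re).mem_nhds (show (1 : ℝ) < ((3 : ℂ) / 2).re by rw [← h32, Complex.ofReal_re]; norm_num)
  have hre' : ∀ᶠ z : ℂ in 𝓝[≠] ((3 : ℂ) / 2), 1 < z.re := hre.filter_mono nhdsWithin_le_nhds
  have hpt : ∀ s ∈ Sp ∪ S, ∀ᶠ z : ℂ in 𝓝[≠] ((3 : ℂ) / 2), z ≠ s := fun s _ => by
    by_cases h : s = (3 : ℂ) / 2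
    · subst h; exact eventually_mem_nhdsWithin.mono fun z hz => hz
    · exact mem_nhdsWithin_of_mem_nhds (isOpen_ne.mem_nhds (Ne.symm h))
  have hD32 : ∀ᶠ z : ℂ in 𝓝[≠] ((3 : ℂ) / 2), z ∈ ({z : ℂ | 1 < z.re} \ (↑(Sp ∪ S) : Set ℂ)) := by
    filter_upwards [hre', (Filter.eventually_all_finset (Sp ∪ S)).2 hpt] with z hz hzs
    exact ⟨hz, fun hmem => hzs z (Finset.mem_coe.1 hmem) rfl⟩
  have hD₁ev : ∀ᶠ z : ℂ in 𝓝[≠] ((3 / 2 : ℂ)), 0 < z.im → z ∈ {z : ℂ | 1 < z.re ∧ 0 < z.im} := hre'.mono fun z hz him => ⟨hz, him⟩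
  have hD₂ev : ∀ᶠ z : ℂ in 𝓝[≠] ((3 / 2 : ℂ)), z.im < 0 → z ∈ {z : ℂ | 1 < z.re ∧ z.im < 0} := hre'.mono fun z hz him => ⟨hz, him⟩
  have hDUPo : IsOpen {z : ℂ | 1 < z.re ∧ 0 < z.im} := (isOpen_lt continuous_const Complex.continuous_re).and (isOpen_lt continuous_const Complex.continuous_im)
  have hDLOo : IsOpen {z : ℂ | 1 < z.re ∧ z.im < 0} := (isOpen_lt continuous_const Complex.continuous_re).and (isOpen_lt Complex.continuous_im continuous_const)
  have hDUPc : IsPreconnected {z : ℂ | 1 < z.re ∧ 0 < z.im} := by rw [Set.setOf_and]; exact ((convex_halfSpace_re_gt (1 : ℝ)).inter (convex_halfSpace_im_gt (0 : ℝ))).isPreconnected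
  have hDLOc : IsPreconnected {z : ℂ | 1 < z.re ∧ z.im < 0} := by rw [Set.setOf_and]; exact ((convex_halfSpace_re_gt (1 : ℝ)).inter (convex_halfSpace_im_lt (0 : ℝ))).isPreconnected
  have hbox : ∀ a b : ℝ, IsOpen {z : ℂ | a < z.re ∧ z.re < b ∧ (0 : ℝ) < z.im ∧ z.im < (1 : ℝ)} := fun a b => (isOpen_lt continuous_const Complex.continuous_re).and
    ((isOpen_lt Complex.continuous_re continuous_const).and ((isOpen_lt continuous_const Complex.continuous_im).and (isOpen_lt Complex.continuous_im continuous_const)))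
  have hbox' : ∀ a b : ℝ, IsOpen {z : ℂ | a < z.re ∧ z.re < b ∧ z.im < (0 : ℝ) ∧ (-1 : ℝ) < z.im} := fun a b => (isOpen_lt continuous_const Complex.continuous_re).and
    ((isOpen_lt Complex.continuous_re continuous_const).and ((isOpen_lt Complex.continuous_im continuous_const).and (isOpen_lt continuous_const Complex.continuous_im)))
  have hO₁ne : ({z : ℂ | (23 : ℝ) / 10 < z.re ∧ z.re < (12 : ℝ) / 5 ∧ (0 : ℝ) < z.im ∧ z.im < (1 : ℝ)}).Nonempty := ⟨⟨47 / 20, 1 / 2⟩, show (23 : ℝ) / 10 < 47 / 20 ∧ (47 / 20 : ℝ) < 12 / 5 ∧ (0 : ℝ) < 1 / 2 ∧ (1 / 2 : ℝ) < 1 by norm_num⟩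
  have hO₂ne : ({z : ℂ | (21 : ℝ) / 10 < z.re ∧ z.re < (11 : ℝ) / 5 ∧ (0 : ℝ) < z.im ∧ z.im < (1 : ℝ)}).Nonempty := ⟨⟨43 / 20, 1 / 2⟩, show (21 : ℝ) / 10 < 43 / 20 ∧ (43 / 20 : ℝ) < 11 / 5 ∧ (0 : ℝ) < 1 / 2 ∧ (1 / 2 : ℝ) < 1 by norm_num⟩
  have hQ₁ne : ({z : ℂ | (23 : ℝ) / 10 < z.re ∧ z.re < (12 : ℝ) / 5 ∧ z.im < (0 : ℝ) ∧ (-1 : ℝ) < z.im}).Nonempty := ⟨⟨47 / 20, -1 / 2⟩, show (23 : ℝ) / 10 < 47 / 20 ∧ (47 / 20 : ℝ) < 12 / 5 ∧ (-1 / 2 : ℝ) < 0 ∧ (-1 : ℝ) < -1 / 2 by norm_num⟩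
  have hQ₂ne : ({z : ℂ | (21 : ℝ) / 10 < z.re ∧ z.re < (11 : ℝ) / 5 ∧ z.im < (0 : ℝ) ∧ (-1 : ℝ) < z.im}).Nonempty := ⟨⟨43 / 20, -1 / 2⟩, show (21 : ℝ) / 10 < 43 / 20 ∧ (43 / 20 : ℝ) < 11 / 5 ∧ (-1 / 2 : ℝ) < 0 ∧ (-1 : ℝ) < -1 / 2 by norm_num⟩
  have hO₁D : {z : ℂ | (23 : ℝ) / 10 < z.re ∧ z.re < (12 : ℝ) / 5 ∧ (0 : ℝ) < z.im ∧ z.im < (1 : ℝ)} ⊆ {z : ℂ | 1 < z.re ∧ 0 < z.im} := fun z hz => ⟨by linarith [hz.1], hz.2.2.1⟩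
  have hO₂D : {z : ℂ | (21 : ℝ) / 10 < z.re ∧ z.re < (11 : ℝ) / 5 ∧ (0 : ℝ) < z.im ∧ z.im < (1 : ℝ)} ⊆ {z : ℂ | 1 < z.re ∧ 0 < z.im} := fun z hz => ⟨by linarith [hz.1], hz.2.2.1⟩
  have hQ₁D : {z : ℂ | (23 : ℝ) / 10 < z.re ∧ z.re < (12 : ℝ) / 5 ∧ z.im < (0 : ℝ) ∧ (-1 : ℝ) < z.im} ⊆ {z : ℂ | 1 < z.re ∧ z.im < 0} := fun z hz => ⟨by linarith [hz.1], hz.2.2.1⟩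
  have hQ₂D : {z : ℂ | (21 : ℝ) / 10 < z.re ∧ z.re < (11 : ℝ) / 5 ∧ z.im < (0 : ℝ) ∧ (-1 : ℝ) < z.im} ⊆ {z : ℂ | 1 < z.re ∧ z.im < 0} := fun z hz => ⟨by linarith [hz.1], hz.2.2.1⟩
  have hsep : ∀ z ∈ {z : ℂ | (23 : ℝ) / 10 < z.re ∧ z.re < (12 : ℝ) / 5 ∧ (0 : ℝ) < z.im ∧ z.im < (1 : ℝ)}, ∀ z' ∈ {z : ℂ | (21 : ℝ) / 10 < z.re ∧ z.re < (11 : ℝ) / 5 ∧ (0 : ℝ) < z.im ∧ z.im < (1 : ℝ)}, 2 < z'.re ∧ z'.re < z.re := fun z hz z' hz' => ⟨by linarith [hz'.1], by linarith [hz.1, hz'.2.1]⟩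
  have hsep₂ : ∀ z ∈ {z : ℂ | (23 : ℝ) / 10 < z.re ∧ z.re < (12 : ℝ) / 5 ∧ z.im < (0 : ℝ) ∧ (-1 : ℝ) < z.im}, ∀ z' ∈ {z : ℂ | (21 : ℝ) / 10 < z.re ∧ z.re < (11 : ℝ) / 5 ∧ z.im < (0 : ℝ) ∧ (-1 : ℝ) < z.im}, 2 < z'.re ∧ z'.re < z.re := fun z hz z' hz' => ⟨by linarith [hz'.1], by linarith [hz.1, hz'.2.1]⟩
  have hFtube₁ : ∀ z ∈ {z : ℂ | 1 < z.re ∧ 0 < z.im}, 2 < z.re → ((Fam z : (quasiSplit (↥(maximalRealSubfield L)) L (IsCMField.complexConj L) 3).L2 μ) : (quasiSplit (↥(maximalRealSubfield L)) L (IsCMField.complexConj L) 3).automorphicQuotient → ℂ) =ᵐ[μ] (quasiSplit (↥(maximalRealSubfield L)) L (IsCMField.complexConj L) 3).quotFun (truncation ν 𝓕 T (eisensteinSeriesU (flatSectionU φ z))) :=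
    fun z hz h2 => by rw [← hEis z h2]; exact hFam z (hDUP hz)
  have hFtube₂ : ∀ z ∈ {z : ℂ | 1 < z.re ∧ z.im < 0}, 2 < z.re → ((Fam z : (quasiSplit (↥(maximalRealSubfield L)) L (IsCMField.complexConj L) 3).L2 μ) : (quasiSplit (↥(maximalRealSubfield L)) L (IsCMField.complexConj L) 3).automorphicQuotient → ℂ) =ᵐ[μ] (quasiSplit (↥(maximalRealSubfield L)) L (IsCMField.complexConj L) 3).quotFun (truncation ν 𝓕 T (eisensteinSeriesU (flatSectionU φ z))) :=
    fun z hz h2 => by rw [← hEis z h2]; exact hFam z (hDLO hz)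
  refine ⟨T, hT, ({z : ℂ | 1 < z.re} \ (↑(Sp ∪ S) : Set ℂ)), σ₀, Fam, hDo, ?_, hDsub, hFd, hσ₀, hDo.mem_nhds hσ₀D, hD32, hFam, ?_⟩
  · exact (isPathConnected_convex_diff_finite (convex_halfSpace_re_gt (1 : ℝ)) (isOpen_lt continuous_const Complex.continuous_re) (Finset.finite_toSet (Sp ∪ S))
      ⟨_, hσ₀D⟩).isConnected.isPreconnected
  · exact msBound_middlePole_of_tube_letters_free L μ (haar : Measure (quasiSplit (↥(maximalRealSubfield L)) L (IsCMField.complexConj L) 3).Adelic) (haar : Measure ↥((standardMaximalCompactGL 3 L).comap (adelicVal (↥(maximalRealSubfield L)) L (IsCMField.complexConj L) 3 ((StdForm.antidiagonal 3).over L)) : Subgroup (quasiSplit (↥(maximalRealSubfield L)) L (IsCMField.complexConj L) 3).Adelic)) (haar : Measure (AdeleRing (𝓞 L) L)ˣ) h𝓕I ν h𝓕N h𝓕1 h𝓕c hβ hT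
      (isUnitary_midBlockChar L ξ hμu) (midBlockChar_posRealIdele L ξ μω hquad) ξ.unit_ψ ξ.hψ hφc (isChiSectionPair_of_mem hφV) hφC
      hDUPo hDUPc (fun z hz => hz) (hbox _ _) hO₁ne hO₁D (hbox _ _) hO₂ne hO₂D hsep
      hDLOo hDLOc (fun z hz => hz) (hbox' _ _) hQ₁ne hQ₁D (hbox' _ _) hQ₂ne hQ₂D hsep₂
      hD₁ev hD₂ev Fam (hFd.mono hDUP) (hFd.mono hDLO) hDo hD32 hFd.continuousOn hFtube₁ hFtube₂
      hwc₁ hwc₂ hwagree hBc₁ hBc₂ hBc₁' hBc₂' hBagree hd hdw hreal hβB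

end OneGenerator

/-- **§2 HEAD. (R)′ OVER L1 `hDISC`, THE BARE CONTINUATION `hCONT`, THE CONTINUED SCALARS `hSCAT`, THE SCALAR ROAD's `hSCAL`** — CONCLUSION: the bytes of ★ p863331 ∕ ★ p863422 ∕ ★
p863518's heads ((R) :284 + `Nonempty 𝔓.ι`).  HYPOTHESES (closed letters): L1 `hDISC`; `hCONT`, `hSCAT` over `hOP`'s frame enriched by `(ν.IsInvInvariant) (ν 𝓕 = 1)` (`hSCAT` also binds
the Borel structure of `𝔸_L^×` and ∀ `μ_K ν_I 𝓕_I`); `hSCAL` (★ p863518's).  PROOF: ★ p863331's spine (★ p862884 ∘ {★ `hdisc_of_admissible`, ★ `hcuspLetters_of_operatorRoad`}) at a NORMALISED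
package (★ `exists_unipotent_haar_fundamentalDomain_cm_three` rescaled by `(ν 𝓕)⁻¹`: Haar by `IsHaarMeasure.smul`, fundamental domain by absolute continuity, inversion-invariance by ★
`isInvInvariant_of_isHaarMeasure_adelicUnipotent_three`); per generator §1, ★ p863518 `ctPackage_of_scalarRoad`, ★ p863422 `opRoadPackage_of_letters`.
[cite: MoeglinWaldspurger1995, I.2.18, IV.1.11, IV.2.3, V.3.13] [cite: Rogawski1990, §13.9 p. 229 (ii)] [cite: Langlands1976, §7] -/
theorem res_midBlock_le_residual_of_letters'''
    (hDISC : ∀ (L : Type) [Field L] [NumberField L] [IsCMField L]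
      (μ : Measure (quasiSplit (↥(maximalRealSubfield L)) L (IsCMField.complexConj L) 3).automorphicQuotient) [(quasiSplit (↥(maximalRealSubfield L)) L (IsCMField.complexConj L) 3).IsAutomorphicMeasure μ]
      (μω : HeckeCharacter L) (_ : μω.IsUnitary) (ξ : OneDimAutRepH L), ∀ (E : Submodule ℂ (resGMidBlock L μ ξ μω).toSubmodule)
          (hE : ∀ k, ∀ x ∈ E, ((resGMidBlock L μ ξ μω).toContRep.restrict (((standardMaximalCompactGL 3 L).comap (adelicVal (↥(maximalRealSubfield L)) L (IsCMField.complexConj L) 3 ((StdForm.antidiagonal 3).over L)) : Subgroup (quasiSplit (↥(maximalRealSubfield L)) L (IsCMField.complexConj L) 3).Adelic)).subtype) k x ∈ E), FiniteDimensional ℂ E →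
          (((resGMidBlock L μ ξ μω).toContRep.restrict (((standardMaximalCompactGL 3 L).comap (adelicVal (↥(maximalRealSubfield L)) L (IsCMField.complexConj L) 3 ((StdForm.antidiagonal 3).over L)) : Subgroup (quasiSplit (↥(maximalRealSubfield L)) L (IsCMField.complexConj L) 3).Adelic)).subtype).subRep E hE).IsIrreducible →
          FiniteDimensional ℂ (Representation.homRangeSum ((resGMidBlock L μ ξ μω).toContRep.restrict (((standardMaximalCompactGL 3 L).comap (adelicVal (↥(maximalRealSubfield L)) L (IsCMField.complexConj L) 3 ((StdForm.antidiagonal 3).over L)) : Subgroup (quasiSplit (↥(maximalRealSubfield L)) L (IsCMField.complexConj L) 3).Adelic)).subtype).toRepresentation (((resGMidBlock L μ ξ μω).toContRep.restrict (((standardMaximalCompactGL 3 L).comap (adelicVal (↥(maximalRealSubfield L)) L (IsCMField.complexConj L) 3 ((StdForm.antidiagonal 3).over L)) : Subgroup (quasiSplit (↥(maximalRealSubfield L)) L (IsCMField.complexConj L) 3).Adelic)).subtype).subRep E hE)))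
    (hCONT : ∀ (L : Type) [Field L] [NumberField L] [IsCMField L]
      [MeasurableSpace (quasiSplit (↥(maximalRealSubfield L)) L (IsCMField.complexConj L) 3).Adelic] [BorelSpace (quasiSplit (↥(maximalRealSubfield L)) L (IsCMField.complexConj L) 3).Adelic]
      (μ : Measure (quasiSplit (↥(maximalRealSubfield L)) L (IsCMField.complexConj L) 3).automorphicQuotient) [(quasiSplit (↥(maximalRealSubfield L)) L (IsCMField.complexConj L) 3).IsAutomorphicMeasure μ]
      (𝔓 : (quasiSplit (↥(maximalRealSubfield L)) L (IsCMField.complexConj L) 3).ParabolicUnipotentData) (_ : ∀ j : 𝔓.ι, 𝔓.radical j = adelicUnipotent (↥(maximalRealSubfield L)) L (IsCMField.complexConj L) 3)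
      (μω : HeckeCharacter L) (_ : μω.IsUnitary)
      (_ : ∀ x : Literature.NumberTheory.GaloisRepresentations.ideleGroup ↥(maximalRealSubfield L),
        μω (AdeleRing.ideleBaseChange (↥(maximalRealSubfield L)) L x) = quadraticHeckeCharCM L x)
      (ξ : OneDimAutRepH L) (K' : Subgroup (quasiSplit (↥(maximalRealSubfield L)) L (IsCMField.complexConj L) 3).Adelic) (ω : ↥K' →* ℂ)
      (φ : (quasiSplit (↥(maximalRealSubfield L)) L (IsCMField.complexConj L) 3).Adelic → ℂ) (_ : φ ∈ chiSectionSpacePair (ξ.bcη⁻¹ * ξ.bcψ⁻¹ * μω) ξ.ψ K' (ω : ↥K' → ℂ)) (_ : Continuous φ)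
      (Ec : ℂ → (quasiSplit (↥(maximalRealSubfield L)) L (IsCMField.complexConj L) 3).Adelic → ℂ) (Sp : Finset ℂ) (_ : ∀ s ∈ Sp, s.im = 0 ∧ 1 < s.re ∧ s.re ≤ 2)
      (_ : ∀ g, DifferentiableOn ℂ (fun z => Ec z g) ({z : ℂ | 1 < z.re} \ (↑Sp : Set ℂ)))
      (_ : ∀ z : ℂ, 2 < z.re → Ec z = eisensteinSeriesU (flatSectionU φ z))
      (Fp : (quasiSplit (↥(maximalRealSubfield L)) L (IsCMField.complexConj L) 3).Adelic → ℂ → ℂ) (_ : ∀ g, AnalyticAt ℂ (Fp g) ((3 : ℂ) / 2))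
      (_ : ∀ g, Fp g =ᶠ[𝓝[≠] ((3 : ℂ) / 2)] fun z => (z - (3 : ℂ) / 2) * Ec z g)
      (f : (quasiSplit (↥(maximalRealSubfield L)) L (IsCMField.complexConj L) 3).L2 μ) (_ : (f : (quasiSplit (↥(maximalRealSubfield L)) L (IsCMField.complexConj L) 3).automorphicQuotient → ℂ) =ᵐ[μ] fun x => Fp (Quotient.out (x : (quasiSplit (↥(maximalRealSubfield L)) L (IsCMField.complexConj L) 3).Adelic ⧸ (quasiSplit (↥(maximalRealSubfield L)) L (IsCMField.complexConj L) 3).quotientSubgroup))⁻¹ ((3 : ℂ) / 2))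
      (ν : Measure ↥(adelicUnipotent (↥(maximalRealSubfield L)) L (IsCMField.complexConj L) 3)) (_ : ν.IsHaarMeasure) (𝓕 : Set ↥(adelicUnipotent (↥(maximalRealSubfield L)) L (IsCMField.complexConj L) 3)) (_ : IsFundamentalDomain ↥(rationalUnipotent (↥(maximalRealSubfield L)) L (IsCMField.complexConj L) 3) 𝓕 ν) (_ : IsCompact (closure 𝓕)) (_ : ν.IsInvInvariant) (_ : ν 𝓕 = 1),
      ∃ (T : ℝ≥0) (_ : 1 ≤ T) (S : Finset ℂ) (_ : ∀ s ∈ S, s.im = 0) (Fam : ℂ → (quasiSplit (↥(maximalRealSubfield L)) L (IsCMField.complexConj L) 3).L2 μ),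
        DifferentiableOn ℂ Fam ({z : ℂ | 1 < z.re} \ (↑(Sp ∪ S) : Set ℂ)) ∧
        ∀ z ∈ ({z : ℂ | 1 < z.re} \ (↑(Sp ∪ S) : Set ℂ)), ((Fam z : (quasiSplit (↥(maximalRealSubfield L)) L (IsCMField.complexConj L) 3).L2 μ) : (quasiSplit (↥(maximalRealSubfield L)) L (IsCMField.complexConj L) 3).automorphicQuotient → ℂ) =ᵐ[μ] (quasiSplit (↥(maximalRealSubfield L)) L (IsCMField.complexConj L) 3).quotFun (truncation ν 𝓕 T (Ec z)))
    (hSCAT : ∀ (L : Type) [Field L] [NumberField L] [IsCMField L]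
      [MeasurableSpace (quasiSplit (↥(maximalRealSubfield L)) L (IsCMField.complexConj L) 3).Adelic] [BorelSpace (quasiSplit (↥(maximalRealSubfield L)) L (IsCMField.complexConj L) 3).Adelic] [MeasurableSpace (AdeleRing (𝓞 L) L)ˣ] [BorelSpace (AdeleRing (𝓞 L) L)ˣ]
      (μ : Measure (quasiSplit (↥(maximalRealSubfield L)) L (IsCMField.complexConj L) 3).automorphicQuotient) [(quasiSplit (↥(maximalRealSubfield L)) L (IsCMField.complexConj L) 3).IsAutomorphicMeasure μ]
      (𝔓 : (quasiSplit (↥(maximalRealSubfield L)) L (IsCMField.complexConj L) 3).ParabolicUnipotentData) (_ : ∀ j : 𝔓.ι, 𝔓.radical j = adelicUnipotent (↥(maximalRealSubfield L)) L (IsCMField.complexConj L) 3)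
      (μω : HeckeCharacter L) (_ : μω.IsUnitary)
      (_ : ∀ x : Literature.NumberTheory.GaloisRepresentations.ideleGroup ↥(maximalRealSubfield L),
        μω (AdeleRing.ideleBaseChange (↥(maximalRealSubfield L)) L x) = quadraticHeckeCharCM L x)
      (ξ : OneDimAutRepH L) (K' : Subgroup (quasiSplit (↥(maximalRealSubfield L)) L (IsCMField.complexConj L) 3).Adelic) (ω : ↥K' →* ℂ)
      (φ : (quasiSplit (↥(maximalRealSubfield L)) L (IsCMField.complexConj L) 3).Adelic → ℂ) (_ : φ ∈ chiSectionSpacePair (ξ.bcη⁻¹ * ξ.bcψ⁻¹ * μω) ξ.ψ K' (ω : ↥K' → ℂ)) (_ : Continuous φ)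
      (Ec : ℂ → (quasiSplit (↥(maximalRealSubfield L)) L (IsCMField.complexConj L) 3).Adelic → ℂ) (Sp : Finset ℂ) (_ : ∀ s ∈ Sp, s.im = 0 ∧ 1 < s.re ∧ s.re ≤ 2)
      (_ : ∀ g, DifferentiableOn ℂ (fun z => Ec z g) ({z : ℂ | 1 < z.re} \ (↑Sp : Set ℂ)))
      (_ : ∀ z : ℂ, 2 < z.re → Ec z = eisensteinSeriesU (flatSectionU φ z))
      (Fp : (quasiSplit (↥(maximalRealSubfield L)) L (IsCMField.complexConj L) 3).Adelic → ℂ → ℂ) (_ : ∀ g, AnalyticAt ℂ (Fp g) ((3 : ℂ) / 2))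
      (_ : ∀ g, Fp g =ᶠ[𝓝[≠] ((3 : ℂ) / 2)] fun z => (z - (3 : ℂ) / 2) * Ec z g)
      (f : (quasiSplit (↥(maximalRealSubfield L)) L (IsCMField.complexConj L) 3).L2 μ) (_ : (f : (quasiSplit (↥(maximalRealSubfield L)) L (IsCMField.complexConj L) 3).automorphicQuotient → ℂ) =ᵐ[μ] fun x => Fp (Quotient.out (x : (quasiSplit (↥(maximalRealSubfield L)) L (IsCMField.complexConj L) 3).Adelic ⧸ (quasiSplit (↥(maximalRealSubfield L)) L (IsCMField.complexConj L) 3).quotientSubgroup))⁻¹ ((3 : ℂ) / 2))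
      (ν : Measure ↥(adelicUnipotent (↥(maximalRealSubfield L)) L (IsCMField.complexConj L) 3)) (_ : ν.IsHaarMeasure) (𝓕 : Set ↥(adelicUnipotent (↥(maximalRealSubfield L)) L (IsCMField.complexConj L) 3)) (_ : IsFundamentalDomain ↥(rationalUnipotent (↥(maximalRealSubfield L)) L (IsCMField.complexConj L) 3) 𝓕 ν) (_ : IsCompact (closure 𝓕)) (_ : ν.IsInvInvariant) (_ : ν 𝓕 = 1),
      ∀ (μK : Measure ↥((standardMaximalCompactGL 3 L).comap (adelicVal (↥(maximalRealSubfield L)) L (IsCMField.complexConj L) 3 ((StdForm.antidiagonal 3).over L)) : Subgroup (quasiSplit (↥(maximalRealSubfield L)) L (IsCMField.complexConj L) 3).Adelic)) (_ : μK.IsHaarMeasure) (νI : Measure (AdeleRing (𝓞 L) L)ˣ) (_ : νI.IsHaarMeasure) (𝓕I : Set (AdeleRing (𝓞 L) L)ˣ) (_ : IsIdeleClassDomain L 𝓕I),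
        ∃ (wc : ℂ → ℂ) (Bc : ℂ → ℂ → ℂ) (d : ℂ → ℂ),
          DifferentiableOn ℂ wc {z : ℂ | 1 < z.re ∧ 0 < z.im} ∧ DifferentiableOn ℂ wc {z : ℂ | 1 < z.re ∧ z.im < 0} ∧ (∀ s : ℂ, 2 < s.re → wc s = ∫ x in {x : (AdeleRing (𝓞 L) L)ˣ | (IdeleClassGroup.ideleNorm L x : ℝ) ≤ 1} ∩ 𝓕I, ((IdeleClassGroup.ideleNorm L x : ℝ) : ℂ) * (((reflectChar (IsCMField.complexConj L) (ξ.bcη⁻¹ * ξ.bcψ⁻¹ * μω) x : ℂˣ) : ℂ) * conj (((ξ.bcη⁻¹ * ξ.bcψ⁻¹ * μω) x : ℂˣ) : ℂ) * (∫ k, (fun g : (quasiSplit (↥(maximalRealSubfield L)) L (IsCMField.complexConj L) 3).Adelic => (∫ v : ↥(adelicUnipotent (↥(maximalRealSubfield L)) L (IsCMField.complexConj L) 3), flatSectionU φ s ((quasiSplit (↥(maximalRealSubfield L)) L (IsCMField.complexConj L) 3).toAdelic (weylLongU ((IsCMField.complexConj L : L ≃ₐ[↥(maximalRealSubfield L)]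 L) : L →+* L) (rfl : (StdForm.antidiagonal 3).over L = (StdForm.antidiagonal 3).over L)) * ((v : (quasiSplit (↥(maximalRealSubfield L)) L (IsCMField.complexConj L) 3).Adelic) * g)) ∂ν) * ((borelHeight g : ℝ) : ℂ) ^ (s - 2)) (k : (quasiSplit (↥(maximalRealSubfield L)) L (IsCMField.complexConj L) 3).Adelic) * conj (φ (k : (quasiSplit (↥(maximalRealSubfield L)) L (IsCMField.complexConj L) 3).Adelic)) ∂μK)) ∂νI) ∧
          (∀ z' ∈ {z : ℂ | 1 < z.re ∧ 0 < z.im}, DifferentiableOn ℂ (fun z : ℂ => Bc z z') {z : ℂ | 1 < z.re ∧ 0 < z.im}) ∧ (∀ z ∈ {z : ℂ | 1 < z.re ∧ 0 < z.im}, DifferentiableOn ℂ (fun u : ℂ => Bc z (conj u)) {u : ℂ | conj u ∈ {z : ℂ | 1 < z.re ∧ 0 < z.im}}) ∧ (∀ z' ∈ {z : ℂ | 1 < z.re ∧ z.im < 0}, DifferentiableOn ℂ (fun z : ℂ => Bc z z') {z : ℂ | 1 < z.re ∧ z.im < 0}) ∧ (∀ z ∈ {z : ℂ | 1 < z.re ∧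 z.im < 0}, DifferentiableOn ℂ (fun u : ℂ => Bc z (conj u)) {u : ℂ | conj u ∈ {z : ℂ | 1 < z.re ∧ z.im < 0}}) ∧ (∀ s s' : ℂ, 2 < s.re → 2 < s'.re → Bc s s' = (∫ x in {x : (AdeleRing (𝓞 L) L)ˣ | (IdeleClassGroup.ideleNorm L x : ℝ) ≤ 1} ∩ 𝓕I, ((IdeleClassGroup.ideleNorm L x : ℝ) : ℂ) ∂νI) * (∫ k, (fun g : (quasiSplit (↥(maximalRealSubfield L)) L (IsCMField.complexConj L) 3).Adelic => (∫ v : ↥(adelicUnipotent (↥(maximalRealSubfield L)) L (IsCMField.complexConj L) 3), flatSectionU φ s ((quasiSplit (↥(maximalRealSubfield L)) L (IsCMField.complexConj L) 3).toAdelic (weylLongU ((IsCMField.complexConj L : L ≃ₐ[↥(maximalRealSubfield L)] L) : L →+* L) (rfl : (StdForm.antidiagonal 3).over L = (StdForm.antidiagonal 3).over L)) * ((v : (quasiSplit (↥(maximalRealSubfield L)) L (IsCMField.complexConj L) 3).Adelic) * g)) ∂ν) * ((borelHeight g : ℝ) : ℂ) ^ (s - 2)) (k : (quasiSplit (↥(maximalRealSubfield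 L)) L (IsCMField.complexConj L) 3).Adelic) * conj ((fun g : (quasiSplit (↥(maximalRealSubfield L)) L (IsCMField.complexConj L) 3).Adelic => (∫ v : ↥(adelicUnipotent (↥(maximalRealSubfield L)) L (IsCMField.complexConj L) 3), flatSectionU φ s' ((quasiSplit (↥(maximalRealSubfield L)) L (IsCMField.complexConj L) 3).toAdelic (weylLongU ((IsCMField.complexConj L : L ≃ₐ[↥(maximalRealSubfield L)] L) : L →+* L) (rfl : (StdForm.antidiagonal 3).over L = (StdForm.antidiagonal 3).over L)) * ((v : (quasiSplit (↥(maximalRealSubfield L)) L (IsCMField.complexConj L) 3).Adelic) * g)) ∂ν) * ((borelHeight g : ℝ) : ℂ) ^ (s' - 2)) (k : (quasiSplit (↥(maximalRealSubfield L)) L (IsCMField.complexConj L) 3).Adelic)) ∂μK)) ∧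
          (AnalyticAt ℂ d (3 / 2 : ℂ)) ∧ (∀ᶠ z in 𝓝[≠] ((3 / 2 : ℂ)), d z = (z - 3 / 2) * wc z) ∧ (∀ᶠ x : ℝ in 𝓝[≠] (3 / 2 : ℝ), (wc (x : ℂ)).im = 0) ∧ (∃ B : ℝ, ∀ᶠ z in 𝓝[≠] ((3 / 2 : ℂ)), ‖z - 3 / 2‖ ^ 2 * ‖Bc z z‖ ≤ B))
    (hSCAL : ∀ (L : Type) [Field L] [NumberField L] [IsCMField L]
      [MeasurableSpace (quasiSplit (↥(maximalRealSubfield L)) L (IsCMField.complexConj L) 3).Adelic] [BorelSpace (quasiSplit (↥(maximalRealSubfield L)) L (IsCMField.complexConj L) 3).Adelic]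
      (μ : Measure (quasiSplit (↥(maximalRealSubfield L)) L (IsCMField.complexConj L) 3).automorphicQuotient) [(quasiSplit (↥(maximalRealSubfield L)) L (IsCMField.complexConj L) 3).IsAutomorphicMeasure μ]
      (𝔓 : (quasiSplit (↥(maximalRealSubfield L)) L (IsCMField.complexConj L) 3).ParabolicUnipotentData) (_ : ∀ j : 𝔓.ι, 𝔓.radical j = adelicUnipotent (↥(maximalRealSubfield L)) L (IsCMField.complexConj L) 3)
      (μω : HeckeCharacter L) (_ : μω.IsUnitary)
      (_ : ∀ x : Literature.NumberTheory.GaloisRepresentations.ideleGroup ↥(maximalRealSubfield L),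
        μω (AdeleRing.ideleBaseChange (↥(maximalRealSubfield L)) L x) = quadraticHeckeCharCM L x)
      (ξ : OneDimAutRepH L) (K' : Subgroup (quasiSplit (↥(maximalRealSubfield L)) L (IsCMField.complexConj L) 3).Adelic) (ω : ↥K' →* ℂ)
      (φ : (quasiSplit (↥(maximalRealSubfield L)) L (IsCMField.complexConj L) 3).Adelic → ℂ) (_ : φ ∈ chiSectionSpacePair (ξ.bcη⁻¹ * ξ.bcψ⁻¹ * μω) ξ.ψ K' (ω : ↥K' → ℂ)) (_ : Continuous φ)
      (Ec : ℂ → (quasiSplit (↥(maximalRealSubfield L)) L (IsCMField.complexConj L) 3).Adelic → ℂ) (Sp : Finset ℂ) (_ : ∀ s ∈ Sp, s.im = 0 ∧ 1 < s.re ∧ s.re ≤ 2)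
      (_ : ∀ g, DifferentiableOn ℂ (fun z => Ec z g) ({z : ℂ | 1 < z.re} \ (↑Sp : Set ℂ)))
      (_ : ∀ z : ℂ, 2 < z.re → Ec z = eisensteinSeriesU (flatSectionU φ z))
      (Fp : (quasiSplit (↥(maximalRealSubfield L)) L (IsCMField.complexConj L) 3).Adelic → ℂ → ℂ) (_ : ∀ g, AnalyticAt ℂ (Fp g) ((3 : ℂ) / 2))
      (_ : ∀ g, Fp g =ᶠ[𝓝[≠] ((3 : ℂ) / 2)] fun z => (z - (3 : ℂ) / 2) * Ec z g)
      (f : (quasiSplit (↥(maximalRealSubfield L)) L (IsCMField.complexConj L) 3).L2 μ) (_ : (f : (quasiSplit (↥(maximalRealSubfield L)) L (IsCMField.complexConj L) 3).automorphicQuotient → ℂ) =ᵐ[μ] fun x => Fp (Quotient.out (x : (quasiSplit (↥(maximalRealSubfield L)) L (IsCMField.complexConj L) 3).Adelic ⧸ (quasiSplit (↥(maximalRealSubfield L)) L (IsCMField.complexConj L) 3).quotientSubgroup))⁻¹ ((3 : ℂ) / 2))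
      (ν : Measure ↥(adelicUnipotent (↥(maximalRealSubfield L)) L (IsCMField.complexConj L) 3)) (_ : ν.IsHaarMeasure) (𝓕 : Set ↥(adelicUnipotent (↥(maximalRealSubfield L)) L (IsCMField.complexConj L) 3)) (_ : IsFundamentalDomain ↥(rationalUnipotent (↥(maximalRealSubfield L)) L (IsCMField.complexConj L) 3) 𝓕 ν) (_ : IsCompact (closure 𝓕)),
      ∃ (qc : ℂ → ℂ) (φt : ℂ → (quasiSplit (↥(maximalRealSubfield L)) L (IsCMField.complexConj L) 3).Adelic → ℂ),
        (∀ᶠ z in 𝓝[≠] ((3 : ℂ) / 2), ∀ g : (quasiSplit (↥(maximalRealSubfield L)) L (IsCMField.complexConj L) 3).Adelic,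
          borelConstantTerm ν 𝓕 (Ec z) g = φ g * (((borelHeight g : ℝ≥0) : ℝ) : ℂ) ^ z + qc z * φt z g * (((borelHeight g : ℝ≥0) : ℝ) : ℂ) ^ (2 - z)) ∧
        (∃ ρ : ℂ, Tendsto (fun z : ℂ => (z - ((3 : ℂ) / 2)) * qc z) (𝓝[≠] ((3 : ℂ) / 2)) (𝓝 ρ)) ∧
        (∀ g : (quasiSplit (↥(maximalRealSubfield L)) L (IsCMField.complexConj L) 3).Adelic, ContinuousAt (fun z => φt z g) ((3 : ℂ) / 2)) ∧
        Measurable (φt ((3 : ℂ) / 2)) ∧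
        (∀ b ∈ arithmeticBorel (↥(maximalRealSubfield L)) L (IsCMField.complexConj L) 3, ∀ x : (quasiSplit (↥(maximalRealSubfield L)) L (IsCMField.complexConj L) 3).Adelic, φt ((3 : ℂ) / 2) ((b : (quasiSplit (↥(maximalRealSubfield L)) L (IsCMField.complexConj L) 3).Adelic) * x) = φt ((3 : ℂ) / 2) x) ∧
        (∀ (u : ↥(adelicUnipotent (↥(maximalRealSubfield L)) L (IsCMField.complexConj L) 3)) (g : (quasiSplit (↥(maximalRealSubfield L)) L (IsCMField.complexConj L) 3).Adelic), φt ((3 : ℂ) / 2) ((u : (quasiSplit (↥(maximalRealSubfield L)) L (IsCMField.complexConj L) 3).Adelic) * g) = φt ((3 : ℂ) / 2) g) ∧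
        ∃ C : ℝ, ∀ g : (quasiSplit (↥(maximalRealSubfield L)) L (IsCMField.complexConj L) 3).Adelic, ‖φt ((3 : ℂ) / 2) g‖ ≤ C) :
    ∀ (L : Type) [Field L] [NumberField L] [IsCMField L]
      (μ : Measure (quasiSplit (↥(maximalRealSubfield L)) L (IsCMField.complexConj L) 3).automorphicQuotient) [(quasiSplit (↥(maximalRealSubfield L)) L (IsCMField.complexConj L) 3).IsAutomorphicMeasure μ]
      (𝔓 : (quasiSplit (↥(maximalRealSubfield L)) L (IsCMField.complexConj L) 3).ParabolicUnipotentData) (_ : ∀ j : 𝔓.ι, 𝔓.radical j = adelicUnipotent (↥(maximalRealSubfield L)) L (IsCMField.complexConj L) 3) (_ : Nonempty 𝔓.ι)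
      (μω : HeckeCharacter L) (_ : μω.IsUnitary),
      (∀ x : Literature.NumberTheory.GaloisRepresentations.ideleGroup ↥(maximalRealSubfield L),
        μω (AdeleRing.ideleBaseChange (↥(maximalRealSubfield L)) L x) = quadraticHeckeCharCM L x) →
      ∀ (ξ : OneDimAutRepH L), resGMidBlock L μ ξ μω ≤ residualSubspace (quasiSplit (↥(maximalRealSubfield L)) L (IsCMField.complexConj L) 3) μ 𝔓 := by
  intro L _ _ _ μ _ 𝔓 h𝔓 hne μω hμu hquad ξ
  letI : MeasurableSpace (quasiSplit (↥(maximalRealSubfield L)) L (IsCMField.complexConj L) 3).Adelic := borel _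
  haveI : BorelSpace (quasiSplit (↥(maximalRealSubfield L)) L (IsCMField.complexConj L) 3).Adelic := ⟨rfl⟩
  letI : MeasurableSpace (AdeleRing (𝓞 L) L)ˣ := borel _
  haveI : BorelSpace (AdeleRing (𝓞 L) L)ˣ := ⟨rfl⟩
  obtain ⟨ν, 𝓕, hν, -, -, h𝓕N, h𝓕c, h𝓕0, h𝓕top⟩ :=
    Summit.HodgeConjecture.HodgeConjecture.Cruxes.H413.K2E1SphericalEisensteinStructuralDataCMThree.exists_unipotent_haar_fundamentalDomain_cm_three L
  haveI := hν
  have hc : IsCMField.complexConj L * IsCMField.complexConj L = 1 := AlgEquiv.ext fun x => IsCMField.complexConj_apply_apply L x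
  haveI hν₁ : ((ν 𝓕)⁻¹ • ν).IsHaarMeasure := Measure.IsHaarMeasure.smul ν (ENNReal.inv_ne_zero.2 h𝓕top) (ENNReal.inv_ne_top.2 h𝓕0)
  haveI hinv₁ : ((ν 𝓕)⁻¹ • ν).IsInvInvariant := Summit.HodgeConjecture.HodgeConjecture.Cruxes.H413.K2E1HeisenbergHaarU3.isInvInvariant_of_isHaarMeasure_adelicUnipotent_three hc _
  have h𝓕N₁ : IsFundamentalDomain ↥(rationalUnipotent (↥(maximalRealSubfield L)) L (IsCMField.complexConj L) 3) 𝓕 ((ν 𝓕)⁻¹ • ν) := h𝓕N.mono smul_absolutelyContinuous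
  have h𝓕1 : ((ν 𝓕)⁻¹ • ν) 𝓕 = 1 := by rw [Measure.smul_apply, smul_eq_mul, ENNReal.inv_mul_cancel h𝓕0 h𝓕top]
  obtain ⟨i⟩ := hne
  refine resGMidBlock_le_residualSubspace_of_disc_of_cuspLetters L μ 𝔓 ξ μω (hdisc_of_admissible L μ ξ μω (hDISC L μ μω hμu ξ))
    (hcuspLetters_of_operatorRoad L μ 𝔓 ξ μω ((ν 𝓕)⁻¹ • ν) h𝓕N₁ h𝓕c i (h𝔓 i) hμu
      (fun K' ω φ hφV hφc Ec Sp hSp hhol hEis Fp hFp hFpE f hf => ?_))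
  obtain ⟨T, hT, S, hS, Fam, hFd, hFam⟩ :=
    hCONT L μ 𝔓 h𝔓 μω hμu hquad ξ K' ω φ hφV hφc Ec Sp hSp hhol hEis Fp hFp hFpE f hf ((ν 𝓕)⁻¹ • ν) hν₁ 𝓕 h𝓕N₁ h𝓕c hinv₁ h𝓕1
  obtain ⟨T', hT', D, σ₀, Fam', hDo, hDc, hDsub, hFd', hσ₀, hσD, hD32, hFam', hMS⟩ :=
    roadData_of_tubeLetters L μ ξ μω hμu hquad hφV hφc Ec hSp hEis ((ν 𝓕)⁻¹ • ν) h𝓕N₁ h𝓕1 h𝓕c hT hS Fam hFd hFam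
      (hSCAT L μ 𝔓 h𝔓 μω hμu hquad ξ K' ω φ hφV hφc Ec Sp hSp hhol hEis Fp hFp hFpE f hf ((ν 𝓕)⁻¹ • ν) hν₁ 𝓕 h𝓕N₁ h𝓕c hinv₁ h𝓕1)
  obtain ⟨qc, φt, hfacCT, ⟨ρ, hρ⟩, hφt, hφtm, hφtB, hφtN, C, hφtbd⟩ :=
    hSCAL L μ 𝔓 h𝔓 μω hμu hquad ξ K' ω φ hφV hφc Ec Sp hSp hhol hEis Fp hFp hFpE f hf ((ν 𝓕)⁻¹ • ν) hν₁ 𝓕 h𝓕N₁ h𝓕c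
  obtain ⟨φ₀, ψ, ρψ, hE3, hψ, hψm, hψB, hψN, K, hψK⟩ :=
    ctPackage_of_scalarRoad L φ Ec Sp ((ν 𝓕)⁻¹ • ν) 𝓕 qc φt hfacCT hρ hφt hφtm hφtB hφtN hφtbd
  exact opRoadPackage_of_letters L μ 𝔓 ξ μω i (h𝔓 i) hφV Ec hSp hhol hEis Fp hFp hFpE f hf ((ν 𝓕)⁻¹ • ν) h𝓕N₁ h𝓕c hT' Fam' hDo hDc hDsub hFd' hσ₀ hσD hD32 hFam' hMS
    φ₀ ψ ρψ hE3 hψ hψm hψB hψN hψK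

end Summit.HodgeConjecture.HodgeConjecture.R90.S8

end
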